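import Mathlib
import Summits.PneNP.PneNP.Theses.OneSlice
import Summits.PneNP.PneNP.Theorems.OneSliceSliceTargetSplit
import Summits.PneNP.PneNP.Theorems.OneSliceShallowSliceBoundNotSharp
import Summits.PneNP.PneNP.Theorems.OneSliceMonotoneContinuationDerandomize
import Summits.PneNP.PneNP.Theorems.OneSliceMonotoneContinuationLevelAverage
import Summits.PneNP.PneNP.Theorems.OneSliceMonotoneContinuationSamplerCircuit
import Summits.PneNP.PneNP.Theorems.OneSliceMonotoneContinuationBinomialMixing
import Summits.PneNP.PneNP.Theorems.OneSliceMonotoneContinuationSamplerExpansion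
import Summits.PneNP.PneNP.Theorems.OneSliceMonotoneContinuationTransportMono
import Summits.PneNP.PneNP.Theorems.OneSliceMonotoneContinuationDefs

/-!
# Skeleton — crux `MonotoneContinuation` (stmt-PneNP-18471, route PneNP/OneSlice), line `Sketch_ideator1_r1`
# driven in PROFILE form (`ProfileLine`)

The transport `T_j 𝟙[C]` of a MONOTONE slice representative is bracketed pointwise by the fixed-rate
deletion / padding samplers of the representative, with `L¹(G(n,p))` gap EXACTLY the binomial average of the
increments of its acceptance PROFILE `i ↦ (fraction of slice i accepted)`. Hence: a small monotone `C̃` that is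
faithful to `C` on slice `j` and has a ONE-SIDED FLAT profile near `j` continues, by a derandomized majority of
`t = O(1/η)` restrictions of itself, to a small monotone circuit `η`-close to `T_j 𝟙[C]` in `L¹(G(n,p_c))`.

Registered stubs (each a `theorem stub_X : <X written out>` with a `Prop`-valued `def X`; the six provable ones are LANDED —
`Summits/PneNP/PneNP/Theorems/OneSliceMonotoneContinuation{TransportMono,LevelAverage,SamplerExpansion,BinomialMixing,SamplerCircuit,Derandomize}.lean` —
and are imported here; only `stub_flatSliceApprox` remains `sorry`):
* `stub_transportMono`   — pointwise monotonicity of the transport in the slice index (monotone `f`);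
* `stub_levelAverage`   — level averages of a transport equal the slice average (double counting);
* `stub_samplerExpansion` — the deletion / padding samplers expand over the levels of the sampled point;
* `stub_binomialMixing` — thinning / superposition identities for binomial weights;
* `stub_samplerCircuit` — a majority of `t` restricted copies of a monotone circuit is a monotone circuit;
* `stub_derandomize`    — averaging + Chebyshev: some `t` fixed restrictions are within `4/t + 5‖U − F‖` of `U`;
* `stub_flatSliceApprox` — the RESIDUAL (content of the crux): a slice-faithful small monotone representative with
  a one-sided flat profile (`FlatSliceApprox`, hardest stub, held by the lead).
`MonotoneContinuation_of : … → OneSlice.MonotoneContinuation` is PROVED below (concludes the crux by name).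

Lead prover-line-stmt-PneNP-18471-0, 2026-08-17. Cards: `one-sided-normal-form` (ideator 1; `LazyAbove` ⟺ flat
profile above), `ignition-profile-sandwich` (ideator 2; `ProfileSandwich`).
-/

set_option linter.dupNamespace false

namespace Summit.PneNP.PneNP.Cruxes.MonotoneContinuation.ProfileLine

open Literature.Computability.Complexity hiding supp mem_supp
open Finset hiding slice
open Filter hiding mem_sdiff
open Classical
open Summit.PneNP.PneNP.Theorems (binomialWeight_tail_le binomialWeight_sum_range binomialWeight_nonneg card_slice
  tendsto_mean eventually_window central_add_le mean_ge)
open Summit.PneNP.PneNP.Theorems.ConstantBand.Negative (Edge thr Central slice)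
open Summit.PneNP.PneNP.Theorems.SingleThreshold.Negative (pc tendsto_pc pc_nonneg)
open Summit.PneNP.PneNP.Theorems.MonotoneContinuation (profile binW meet join delSampler padSampler majVote)
open Summit.PneNP.PneNP.Theorems.SliceTargetSplit (Comp nbhd mem_nbhd transport ind l1 nbhdCard ind_nonneg ind_le_one
  abs_ind_sub_ind l1_comm l1_nonneg l1_triangle l1_eq_sum_slices card_nbhd card_nbhd_of_le card_nbhd_of_ge
  choose_mul_nbhdCard nbhdCard_pos sum_slice_sum_nbhd sum_slice_sum_nbhd_left transport_nonneg transport_sub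
  l1_transport_le rdist_eq_l1 transport_ind_mem)

noncomputable section

variable {n : ℕ}

/-! ## Vocabulary
`profile`, `binW`, `meet`, `join`, `delSampler`, `padSampler`, `majVote` come from the landed vocabulary file
`Summits/PneNP/PneNP/Theorems/OneSliceMonotoneContinuationDefs.lean` (namespace `…Theorems.MonotoneContinuation`, p145563). -/

/-! ## The obligations (statements) -/

/-- **TransportMono.** For a monotone Boolean `f` and slices `j ≤ j' ≤ C(n,2)`, the transport from slice `j` is
pointwise below the transport from slice `j'` (couple a uniform `j`-subset inside a uniform `j'`-subset, resp.
supersets; in the mixed regime both are compared with `f y`). [folklore] -/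
def TransportMono : Prop :=
  ∀ (n j j' : ℕ) (f : (Edge n → Bool) → Bool), Monotone f → j ≤ j' → j' ≤ n.choose 2 →
    ∀ y : Edge n → Bool, transport j (ind f) y ≤ transport j' (ind f) y

/-- **LevelAverage.** Summing the slice-`j` transport of any real `g` over the level `i` gives `#slice_i` times
the slice-`j` average of `g` (`i, j ≤ C(n,2)`; double counting + reciprocity `C(N,i)D(N,i,j) = C(N,j)D(N,j,i)`).
[folklore] -/
def LevelAverage : Prop :=
  ∀ (n i j : ℕ) (g : (Edge n → Bool) → ℝ), i ≤ n.choose 2 → j ≤ n.choose 2 →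
    ∑ y ∈ slice n i, transport j g y = (#(slice n i) : ℝ) * ((∑ x ∈ slice n j, g x) / #(slice n j))

/-- **SamplerExpansion.** The deletion sampler is the `Bin(|y|, 1-q)`-mixture of the downward transports of
`𝟙[f]` at `y` (group `ρ` by `ρ ∩ supp y`; a uniform `r`-subset of `supp y` is a uniform point of `nbhd r y`),
and the padding sampler is the `|y| + Bin(N-|y|, q)`-mixture of the upward transports (group `ρ` by
`ρ ∖ supp y`). Pure double counting; `f` arbitrary. [folklore] -/
def SamplerExpansion : Prop :=
  (∀ (n : ℕ) (q : ℝ) (f : (Edge n → Bool) → Bool) (y : Edge n → Bool),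
    (∑ ρ : Edge n → Bool, gnpWeight n (1 - q) ρ * ind f (fun e => y e && ρ e)) =
      ∑ r ∈ range (edgeCount y + 1),
        ((edgeCount y).choose r : ℝ) * (1 - q) ^ r * (1 - (1 - q)) ^ (edgeCount y - r) * transport r (ind f) y) ∧
  (∀ (n : ℕ) (q : ℝ) (f : (Edge n → Bool) → Bool) (y : Edge n → Bool),
    (∑ ρ : Edge n → Bool, gnpWeight n q ρ * ind f (fun e => y e || ρ e)) =
      ∑ r ∈ range (n.choose 2 - edgeCount y + 1),
        ((n.choose 2 - edgeCount y).choose r : ℝ) * q ^ r * (1 - q) ^ (n.choose 2 - edgeCount y - r) *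
          transport (edgeCount y + r) (ind f) y)

/-- Folded form of `SamplerExpansion` (deletion). -/
theorem SamplerExpansion.del_eq (hE : SamplerExpansion) (n : ℕ) (q : ℝ) (f : (Edge n → Bool) → Bool)
    (y : Edge n → Bool) :
    delSampler q f y = ∑ r ∈ range (edgeCount y + 1), binW (edgeCount y) (1 - q) r * transport r (ind f) y :=
  hE.1 n q f y

/-- Folded form of `SamplerExpansion` (padding). -/
theorem SamplerExpansion.pad_eq (hE : SamplerExpansion) (n : ℕ) (q : ℝ) (f : (Edge n → Bool) → Bool)
    (y : Edge n → Bool) :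
    padSampler q f y = ∑ r ∈ range (n.choose 2 - edgeCount y + 1),
      binW (n.choose 2 - edgeCount y) q r * transport (edgeCount y + r) (ind f) y :=
  hE.2 n q f y

/-- **BinomialMixing.** Thinning: `Σ_s Bin(N,p)(s)·Bin(s,θ)(r) = Bin(N,pθ)(r)`; superposition:
`Σ_{s ≤ r} Bin(N,p)(s)·Bin(N-s,θ)(r-s) = Bin(N, p+θ-pθ)(r)`. [folklore] -/
def BinomialMixing : Prop :=
  (∀ (N r : ℕ) (p θ : ℝ),
    ∑ s ∈ range (N + 1), ((N.choose s : ℝ) * p ^ s * (1 - p) ^ (N - s)) * ((s.choose r : ℝ) * θ ^ r * (1 - θ) ^ (s - r)) =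
      (N.choose r : ℝ) * (p * θ) ^ r * (1 - p * θ) ^ (N - r)) ∧
  (∀ (N r : ℕ) (p θ : ℝ), r ≤ N →
    ∑ s ∈ range (r + 1), ((N.choose s : ℝ) * p ^ s * (1 - p) ^ (N - s)) *
        (((N - s).choose (r - s) : ℝ) * θ ^ (r - s) * (1 - θ) ^ (N - s - (r - s))) =
      (N.choose r : ℝ) * (p + θ - p * θ) ^ r * (1 - (p + θ - p * θ)) ^ (N - r))

/-- Folded form of `BinomialMixing` (thinning). -/
theorem BinomialMixing.thin (hB : BinomialMixing) (N r : ℕ) (p θ : ℝ) :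
    ∑ s ∈ range (N + 1), binW N p s * binW s θ r = binW N (p * θ) r :=
  hB.1 N r p θ

/-- Folded form of `BinomialMixing` (superposition). -/
theorem BinomialMixing.sup (hB : BinomialMixing) (N r : ℕ) (p θ : ℝ) (hr : r ≤ N) :
    ∑ s ∈ range (r + 1), binW N p s * binW (N - s) θ (r - s) = binW N (p + θ - p * θ) r :=
  hB.2 N r p θ hr

/-- **SamplerCircuit.** A majority vote of `t` restricted copies `y ↦ C(y ∧ ρ_a)` (deletion) or `y ↦ C(y ∨ ρ_a)`
(padding) of a monotone circuit `C` is computed — on every input other than the all-false and the all-true vector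
(the monotone basis has no constants: build over `monotoneBasis01`, eliminate constants by
`const_or_exists_monotone_circuit`, and replace a constant outcome by `⋀ inputs` / `⋁ inputs`) — by a monotone
circuit of size `≤ t·(|C| + 2N + 2) + 4t² + 4`, `N = C(n,2)`, `n ≥ 2`, `t ≥ 1`. [folklore] -/
def SamplerCircuit : Prop :=
  ∀ (n t : ℕ), 2 ≤ n → 0 < t → ∀ (C : Circuit (Edge n)), C.IsOver monotoneBasis → ∀ (ρs : Fin t → Edge n → Bool),
    (∃ M : Circuit (Edge n), M.IsOver monotoneBasis ∧ M.size ≤ t * (C.size + 2 * n.choose 2 + 2) + 4 * t ^ 2 + 4 ∧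
      ∀ y : Edge n → Bool, (∃ e, y e = false) → (∃ e, y e = true) →
        M.eval y = decide (t < 2 * #(univ.filter fun a : Fin t => C.eval (fun e => y e && ρs a e) = true))) ∧
    (∃ M : Circuit (Edge n), M.IsOver monotoneBasis ∧ M.size ≤ t * (C.size + 2 * n.choose 2 + 2) + 4 * t ^ 2 + 4 ∧
      ∀ y : Edge n → Bool, (∃ e, y e = false) → (∃ e, y e = true) →
        M.eval y = decide (t < 2 * #(univ.filter fun a : Fin t => C.eval (fun e => y e || ρs a e) = true)))

/-- Folded form of `SamplerCircuit` (deletion). -/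
theorem SamplerCircuit.meet_case (hS : SamplerCircuit) (n t : ℕ) (hn : 2 ≤ n) (ht : 0 < t) (C : Circuit (Edge n))
    (hC : C.IsOver monotoneBasis) (ρs : Fin t → Edge n → Bool) :
    ∃ M : Circuit (Edge n), M.IsOver monotoneBasis ∧ M.size ≤ t * (C.size + 2 * n.choose 2 + 2) + 4 * t ^ 2 + 4 ∧
      ∀ y : Edge n → Bool, (∃ e, y e = false) → (∃ e, y e = true) →
        M.eval y = majVote (fun a y => C.eval (meet y (ρs a))) y :=
  (hS n t hn ht C hC ρs).1

/-- Folded form of `SamplerCircuit` (padding). -/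
theorem SamplerCircuit.join_case (hS : SamplerCircuit) (n t : ℕ) (hn : 2 ≤ n) (ht : 0 < t) (C : Circuit (Edge n))
    (hC : C.IsOver monotoneBasis) (ρs : Fin t → Edge n → Bool) :
    ∃ M : Circuit (Edge n), M.IsOver monotoneBasis ∧ M.size ≤ t * (C.size + 2 * n.choose 2 + 2) + 4 * t ^ 2 + 4 ∧
      ∀ y : Edge n → Bool, (∃ e, y e = false) → (∃ e, y e = true) →
        M.eval y = majVote (fun a y => C.eval (join y (ρs a))) y :=
  (hS n t hn ht C hC ρs).2

/-- **Derandomize.** For a probability vector `w` on restrictions and Boolean tests `g ρ`, some `t` FIXED restrictions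
have majority vote within `4/t + 5‖U − 𝟙[G]‖` of the average `U = Σ_ρ w ρ 𝟙[g ρ]` in `L¹(G(n,p))`, for every Boolean
`G` (average over `w^{⊗t}`, then Chebyshev for `Bin(t,u)` and `min(u,1-u) ≤ |u − b|`). [folklore] -/
def Derandomize : Prop :=
  ∀ (n t : ℕ), 0 < t → ∀ (p : ℝ), 0 ≤ p → p ≤ 1 →
    ∀ (w : (Edge n → Bool) → ℝ), (∀ ρ, 0 ≤ w ρ) → ∑ ρ, w ρ = 1 →
    ∀ (g : (Edge n → Bool) → (Edge n → Bool) → Bool) (G : (Edge n → Bool) → Bool),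
      ∃ ρs : Fin t → Edge n → Bool,
        l1 n p (ind fun y => decide (t < 2 * #(univ.filter fun a : Fin t => g (ρs a) y = true)))
            (fun y => ∑ ρ, w ρ * ind (g ρ) y) ≤
          4 / t + 5 * l1 n p (fun y => ∑ ρ, w ρ * ind (g ρ) y) (ind G)

/-- Folded form of `Derandomize`. -/
theorem Derandomize.maj (hD : Derandomize) (n t : ℕ) (ht : 0 < t) (p : ℝ) (hp0 : 0 ≤ p) (hp1 : p ≤ 1)
    (w : (Edge n → Bool) → ℝ) (hw : ∀ ρ, 0 ≤ w ρ) (hw1 : ∑ ρ, w ρ = 1)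
    (g : (Edge n → Bool) → (Edge n → Bool) → Bool) (G : (Edge n → Bool) → Bool) :
    ∃ ρs : Fin t → Edge n → Bool,
      l1 n p (ind (majVote fun a => g (ρs a))) (fun y => ∑ ρ, w ρ * ind (g ρ) y) ≤
        4 / t + 5 * l1 n p (fun y => ∑ ρ, w ρ * ind (g ρ) y) (ind G) :=
  hD n t ht p hp0 hp1 w hw hw1 g G

/-- **FlatSliceApprox** — the RESIDUAL of the line (conjecture-grade; the content of the crux). For every small
monotone `C` whose slice-`j` transport is `ε`-close in `L¹(G(n,p_c))` to some monotone Boolean function there is a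
small monotone `C₁` that is `η`-FAITHFUL to `C` on slice `j` and whose acceptance profile is `η`-FLAT on ONE side of
`j` across `L·⌊√j⌋` slices (`∀ L` before `∃ ε`; `c₁` depends on `c` only; the profile `profile C₁.eval i` is written out
as `(Σ_{slice i} 𝟙[C₁]) / #slice_i`). Slice-faithfulness alone is trivial
(`C₁ = C`), flatness alone is trivial (`C₁` near-constant); the conjunction is the crux (`MC ⟹ FSA` by
`C₁ := C'(· ∪ R)`). [folklore] -/
def FlatSliceApprox : Prop :=
  ∀ c : ℕ, ∃ c₁ : ℕ, ∀ k : ℕ, 3 ≤ k → ∀ η : ℝ, 0 < η → ∀ L : ℕ, ∃ ε : ℝ, 0 < ε ∧ ∀ᶠ n : ℕ in atTop,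
    ∀ j : ℕ, Central k n j → ∀ C : Circuit (Edge n), C.IsOver monotoneBasis → C.size ≤ n ^ c →
      (∃ F : (Edge n → Bool) → Bool, Monotone F ∧ l1 n (pc n k) (ind F) (transport j (ind C.eval)) ≤ ε) →
      ∃ C₁ : Circuit (Edge n), C₁.IsOver monotoneBasis ∧ C₁.size ≤ n ^ c₁ ∧
        (∑ x ∈ slice n j, |ind C₁.eval x - ind C.eval x|) ≤ η * #(slice n j) ∧
        ((∀ r : ℕ, r ≤ L * Nat.sqrt j →
            (∑ x ∈ slice n (j + r), ind C₁.eval x) / #(slice n (j + r)) - (∑ x ∈ slice n j, ind C₁.eval x) / #(slice n j) ≤ η) ∨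
         (∀ r : ℕ, r ≤ L * Nat.sqrt j →
            (∑ x ∈ slice n j, ind C₁.eval x) / #(slice n j) - (∑ x ∈ slice n (j - r), ind C₁.eval x) / #(slice n (j - r)) ≤ η))

/-! ## Registered stubs (types written out in tree vocabulary; `stub_X : X` holds by `Iff.rfl`) -/

/-- **STUB · transportMono** (M) — the statement `TransportMono` written out. -/
theorem stub_transportMono :
  ∀ (n j j' : ℕ) (f : (Edge n → Bool) → Bool), Monotone f → j ≤ j' → j' ≤ n.choose 2 →
    ∀ y : Edge n → Bool, transport j (ind f) y ≤ transport j' (ind f) y :=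
  Summit.PneNP.PneNP.Theorems.MonotoneContinuation.stub_transportMono

/-- **STUB · levelAverage** (S/M) — the statement `LevelAverage` written out. -/
theorem stub_levelAverage :
  ∀ (n i j : ℕ) (g : (Edge n → Bool) → ℝ), i ≤ n.choose 2 → j ≤ n.choose 2 →
    ∑ y ∈ slice n i, transport j g y = (#(slice n i) : ℝ) * ((∑ x ∈ slice n j, g x) / #(slice n j)) :=
  Summit.PneNP.PneNP.Theorems.MonotoneContinuation.stub_levelAverage

/-- **STUB · samplerExpansion** (M) — the statement `SamplerExpansion` written out. -/
theorem stub_samplerExpansion :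
  (∀ (n : ℕ) (q : ℝ) (f : (Edge n → Bool) → Bool) (y : Edge n → Bool),
    (∑ ρ : Edge n → Bool, gnpWeight n (1 - q) ρ * ind f (fun e => y e && ρ e)) =
      ∑ r ∈ range (edgeCount y + 1),
        ((edgeCount y).choose r : ℝ) * (1 - q) ^ r * (1 - (1 - q)) ^ (edgeCount y - r) * transport r (ind f) y) ∧
  (∀ (n : ℕ) (q : ℝ) (f : (Edge n → Bool) → Bool) (y : Edge n → Bool),
    (∑ ρ : Edge n → Bool, gnpWeight n q ρ * ind f (fun e => y e || ρ e)) =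
      ∑ r ∈ range (n.choose 2 - edgeCount y + 1),
        ((n.choose 2 - edgeCount y).choose r : ℝ) * q ^ r * (1 - q) ^ (n.choose 2 - edgeCount y - r) *
          transport (edgeCount y + r) (ind f) y) :=
  Summit.PneNP.PneNP.Theorems.MonotoneContinuation.stub_samplerExpansion

/-- **STUB · binomialMixing** (S/M) — the statement `BinomialMixing` written out. -/
theorem stub_binomialMixing :
  (∀ (N r : ℕ) (p θ : ℝ),
    ∑ s ∈ range (N + 1), ((N.choose s : ℝ) * p ^ s * (1 - p) ^ (N - s)) * ((s.choose r : ℝ) * θ ^ r * (1 - θ) ^ (s - r)) =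
      (N.choose r : ℝ) * (p * θ) ^ r * (1 - p * θ) ^ (N - r)) ∧
  (∀ (N r : ℕ) (p θ : ℝ), r ≤ N →
    ∑ s ∈ range (r + 1), ((N.choose s : ℝ) * p ^ s * (1 - p) ^ (N - s)) *
        (((N - s).choose (r - s) : ℝ) * θ ^ (r - s) * (1 - θ) ^ (N - s - (r - s))) =
      (N.choose r : ℝ) * (p + θ - p * θ) ^ r * (1 - (p + θ - p * θ)) ^ (N - r)) :=
  Summit.PneNP.PneNP.Theorems.MonotoneContinuation.stub_binomialMixing

/-- **STUB · samplerCircuit** (M; circuit plumbing) — the statement `SamplerCircuit` written out. -/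
theorem stub_samplerCircuit :
  ∀ (n t : ℕ), 2 ≤ n → 0 < t → ∀ (C : Circuit (Edge n)), C.IsOver monotoneBasis → ∀ (ρs : Fin t → Edge n → Bool),
    (∃ M : Circuit (Edge n), M.IsOver monotoneBasis ∧ M.size ≤ t * (C.size + 2 * n.choose 2 + 2) + 4 * t ^ 2 + 4 ∧
      ∀ y : Edge n → Bool, (∃ e, y e = false) → (∃ e, y e = true) →
        M.eval y = decide (t < 2 * #(univ.filter fun a : Fin t => C.eval (fun e => y e && ρs a e) = true))) ∧
    (∃ M : Circuit (Edge n), M.IsOver monotoneBasis ∧ M.size ≤ t * (C.size + 2 * n.choose 2 + 2) + 4 * t ^ 2 + 4 ∧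
      ∀ y : Edge n → Bool, (∃ e, y e = false) → (∃ e, y e = true) →
        M.eval y = decide (t < 2 * #(univ.filter fun a : Fin t => C.eval (fun e => y e || ρs a e) = true))) :=
  Summit.PneNP.PneNP.Theorems.MonotoneContinuation.stub_samplerCircuit

/-- **STUB · derandomize** (M) — the statement `Derandomize` written out. -/
theorem stub_derandomize :
  ∀ (n t : ℕ), 0 < t → ∀ (p : ℝ), 0 ≤ p → p ≤ 1 →
    ∀ (w : (Edge n → Bool) → ℝ), (∀ ρ, 0 ≤ w ρ) → ∑ ρ, w ρ = 1 →
    ∀ (g : (Edge n → Bool) → (Edge n → Bool) → Bool) (G : (Edge n → Bool) → Bool),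
      ∃ ρs : Fin t → Edge n → Bool,
        l1 n p (ind fun y => decide (t < 2 * #(univ.filter fun a : Fin t => g (ρs a) y = true)))
            (fun y => ∑ ρ, w ρ * ind (g ρ) y) ≤
          4 / t + 5 * l1 n p (fun y => ∑ ρ, w ρ * ind (g ρ) y) (ind G) :=
  Summit.PneNP.PneNP.Theorems.MonotoneContinuation.stub_derandomize

/-- **STUB · flatSliceApprox** (the residual; hardest; lead) — the statement `FlatSliceApprox` written out. -/
theorem stub_flatSliceApprox :
  ∀ c : ℕ, ∃ c₁ : ℕ, ∀ k : ℕ, 3 ≤ k → ∀ η : ℝ, 0 < η → ∀ L : ℕ, ∃ ε : ℝ, 0 < ε ∧ ∀ᶠ n : ℕ in atTop,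
    ∀ j : ℕ, Central k n j → ∀ C : Circuit (Edge n), C.IsOver monotoneBasis → C.size ≤ n ^ c →
      (∃ F : (Edge n → Bool) → Bool, Monotone F ∧ l1 n (pc n k) (ind F) (transport j (ind C.eval)) ≤ ε) →
      ∃ C₁ : Circuit (Edge n), C₁.IsOver monotoneBasis ∧ C₁.size ≤ n ^ c₁ ∧
        (∑ x ∈ slice n j, |ind C₁.eval x - ind C.eval x|) ≤ η * #(slice n j) ∧
        ((∀ r : ℕ, r ≤ L * Nat.sqrt j →
            (∑ x ∈ slice n (j + r), ind C₁.eval x) / #(slice n (j + r)) - (∑ x ∈ slice n j, ind C₁.eval x) / #(slice n j) ≤ η) ∨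
         (∀ r : ℕ, r ≤ L * Nat.sqrt j →
            (∑ x ∈ slice n j, ind C₁.eval x) / #(slice n j) - (∑ x ∈ slice n (j - r), ind C₁.eval x) / #(slice n (j - r)) ≤ η)) := by
  sorry

/-! ## Name-keyed aliases (the skeleton audit admits a hypothesis of the composition only if it is NAMED like a stub) -/
namespace Registered

/-- Alias keyed by the registered stub name. -/
abbrev stub_transportMono : Prop := TransportMono
/-- Alias keyed by the registered stub name. -/
abbrev stub_levelAverage : Prop := LevelAverage
/-- Alias keyed by the registered stub name. -/
abbrev stub_samplerExpansion : Prop := SamplerExpansion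
/-- Alias keyed by the registered stub name. -/
abbrev stub_binomialMixing : Prop := BinomialMixing
/-- Alias keyed by the registered stub name. -/
abbrev stub_samplerCircuit : Prop := SamplerCircuit
/-- Alias keyed by the registered stub name. -/
abbrev stub_derandomize : Prop := Derandomize
/-- Alias keyed by the registered stub name. -/
abbrev stub_flatSliceApprox : Prop := FlatSliceApprox

end Registered

/-! ## Elementary facts -/

/-- Binomial weights are nonnegative on `[0,1]`. -/
theorem binW_nonneg {N : ℕ} {p : ℝ} (hp0 : 0 ≤ p) (hp1 : p ≤ 1) (r : ℕ) : 0 ≤ binW N p r :=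
  mul_nonneg (mul_nonneg (Nat.cast_nonneg _) (pow_nonneg hp0 _)) (pow_nonneg (sub_nonneg.2 hp1) _)

/-- Binomial weights sum to `1`. -/
theorem binW_sum (N : ℕ) (p : ℝ) : ∑ r ∈ range (N + 1), binW N p r = 1 :=
  binomialWeight_sum_range (b := binW N p) (fun _ => rfl)

/-- Binomial weights vanish beyond `N`. -/
theorem binW_eq_zero_of_lt {N r : ℕ} (h : N < r) (p : ℝ) : binW N p r = 0 := by
  simp [binW, Nat.choose_eq_zero_of_lt h]

/-- Edge counts are at most `C(n,2)`. -/
theorem edgeCount_le (y : Edge n → Bool) : edgeCount y ≤ n.choose 2 := by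
  rw [edgeCount, ← card_edgeSet_top_fin n, ← card_univ]; exact card_filter_le _ _

/-- Slices inside the cube are nonempty. -/
theorem card_slice_pos {i : ℕ} (hi : i ≤ n.choose 2) : 0 < #(slice n i) := by
  rw [card_slice]; exact Nat.choose_pos hi

/-- Profiles are nonnegative. -/
theorem profile_nonneg (f : (Edge n → Bool) → Bool) (i : ℕ) : 0 ≤ profile f i :=
  div_nonneg (sum_nonneg fun x _ => ind_nonneg f x) (Nat.cast_nonneg _)

/-- Profiles are at most `1`. -/
theorem profile_le_one (f : (Edge n → Bool) → Bool) (i : ℕ) : profile f i ≤ 1 := by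
  unfold profile
  rcases Nat.eq_zero_or_pos #(slice n i) with h | h
  · rw [h, Nat.cast_zero, div_zero]; exact zero_le_one
  · rw [div_le_one (by exact_mod_cast h)]
    calc ∑ x ∈ slice n i, ind f x ≤ ∑ x ∈ slice n i, (1 : ℝ) := sum_le_sum fun x _ => ind_le_one f x
      _ = #(slice n i) := by rw [sum_const, nsmul_eq_mul, mul_one]

/-- Profile increments are at most `1` in absolute value. -/
theorem abs_profile_sub_le (f : (Edge n → Bool) → Bool) (i j : ℕ) : |profile f i - profile f j| ≤ 1 := by
  have := profile_nonneg f i; have := profile_le_one f i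
  have := profile_nonneg f j; have := profile_le_one f j
  rw [abs_sub_le_iff]; constructor <;> linarith

/-- Regrouping a `G(n,p)`-weighted sum by edge count. -/
theorem sum_eq_sum_slices (p : ℝ) (φ : ℕ → ℝ) (h : (Edge n → Bool) → ℝ) :
    ∑ y, gnpWeight n p y * φ (edgeCount y) * h y =
      ∑ s ∈ range (n.choose 2 + 1), p ^ s * (1 - p) ^ (n.choose 2 - s) * φ s * ∑ y ∈ slice n s, h y := by
  rw [← sum_fiberwise_of_maps_to (g := edgeCount) (t := range (n.choose 2 + 1)) (s := univ)]
  · refine sum_congr rfl fun s _ => ?_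
    rw [mul_sum]
    refine sum_congr rfl fun y hy => ?_
    rw [gnpWeight, (mem_filter.1 hy).2]
  · intro x _
    rw [mem_range, Nat.lt_succ_iff]
    exact edgeCount_le x

/-! ## Consequences of `LevelAverage` and `TransportMono` -/

/-- Level sums of a transported indicator. -/
theorem sum_slice_transport_ind (hL : LevelAverage) (f : (Edge n → Bool) → Bool) {i j : ℕ}
    (hi : i ≤ n.choose 2) (hj : j ≤ n.choose 2) :
    ∑ y ∈ slice n i, transport j (ind f) y = #(slice n i) * profile f j :=
  hL n i j (ind f) hi hj

/-- **Weighted level identity.** `Σ_y w_p(y) φ(|y|) (T_m 𝟙[f])(y) = profile f m · Σ_s Bin(N,p)(s) φ(s)`. -/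
theorem weighted_transport_eq (hL : LevelAverage) (p : ℝ) (φ : ℕ → ℝ) (f : (Edge n → Bool) → Bool) {m : ℕ}
    (hm : m ≤ n.choose 2) :
    ∑ y, gnpWeight n p y * φ (edgeCount y) * transport m (ind f) y =
      profile f m * ∑ s ∈ range (n.choose 2 + 1), binW (n.choose 2) p s * φ s := by
  rw [sum_eq_sum_slices, mul_sum]
  refine sum_congr rfl fun s hs => ?_
  have hsN : s ≤ n.choose 2 := Nat.lt_succ_iff.1 (mem_range.1 hs)
  rw [sum_slice_transport_ind hL f hsN hm, card_slice, binW]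
  ring

/-- The profile of a monotone function is non-decreasing in the slice index (inside the cube). -/
theorem profile_mono (hA : TransportMono) (hL : LevelAverage) {f : (Edge n → Bool) → Bool} (hf : Monotone f)
    {r r' : ℕ} (hrr' : r ≤ r') (hr' : r' ≤ n.choose 2) : profile f r ≤ profile f r' := by
  have h0 : (0 : ℕ) ≤ n.choose 2 := Nat.zero_le _
  have hpos : (0 : ℝ) < #(slice n 0) := by exact_mod_cast card_slice_pos h0
  have key : ∑ y ∈ slice n 0, transport r (ind f) y ≤ ∑ y ∈ slice n 0, transport r' (ind f) y :=
    sum_le_sum fun y _ => hA n r r' f hf hrr' hr' y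
  rw [sum_slice_transport_ind hL f h0 (hrr'.trans hr'), sum_slice_transport_ind hL f h0 hr'] at key
  exact le_of_mul_le_mul_left key hpos

/-- One level of the sampler error with the sign removed: for `r, j ≤ N` and `φ ≥ 0`,
`Σ_y w_p(y) φ(|y|) |T_r − T_j|(y) ≤ (Σ_s Bin(N,p)(s) φ(s)) · |profile r − profile j|`. -/
theorem weighted_abs_transport_sub_le (hA : TransportMono) (hL : LevelAverage) {p : ℝ} (hp0 : 0 ≤ p) (hp1 : p ≤ 1)
    {φ : ℕ → ℝ} (hφ : ∀ s, 0 ≤ φ s) (f : (Edge n → Bool) → Bool) (hf : Monotone f) {r j : ℕ}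
    (hr : r ≤ n.choose 2) (hj : j ≤ n.choose 2) :
    ∑ y, gnpWeight n p y * φ (edgeCount y) * |transport r (ind f) y - transport j (ind f) y| ≤
      (∑ s ∈ range (n.choose 2 + 1), binW (n.choose 2) p s * φ s) * |profile f r - profile f j| := by
  set B : ℝ := ∑ s ∈ range (n.choose 2 + 1), binW (n.choose 2) p s * φ s with hB
  have hB0 : 0 ≤ B := sum_nonneg fun s _ => mul_nonneg (binW_nonneg hp0 hp1 s) (hφ s)
  rcases le_or_gt r j with hrj | hjr
  · -- `T_r ≤ T_j` pointwise
    have hpt : ∀ y, |transport r (ind f) y - transport j (ind f) y| =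
        transport j (ind f) y - transport r (ind f) y := fun y => by
      rw [abs_sub_comm]; exact abs_of_nonneg (sub_nonneg.2 (hA n r j f hf hrj hj y))
    simp_rw [hpt, mul_sub]
    rw [sum_sub_distrib, weighted_transport_eq hL p φ f hj, weighted_transport_eq hL p φ f hr, ← hB]
    calc profile f j * B - profile f r * B = (profile f j - profile f r) * B := by ring
      _ ≤ |profile f r - profile f j| * B := by
          refine mul_le_mul_of_nonneg_right ?_ hB0
          rw [abs_sub_comm]; exact le_abs_self _
      _ = B * |profile f r - profile f j| := by ring
  · -- `T_j ≤ T_r` pointwise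
    have hpt : ∀ y, |transport r (ind f) y - transport j (ind f) y| =
        transport r (ind f) y - transport j (ind f) y := fun y =>
      abs_of_nonneg (sub_nonneg.2 (hA n j r f hf hjr.le hr y))
    simp_rw [hpt, mul_sub]
    rw [sum_sub_distrib, weighted_transport_eq hL p φ f hj, weighted_transport_eq hL p φ f hr, ← hB]
    calc profile f r * B - profile f j * B = (profile f r - profile f j) * B := by ring
      _ ≤ |profile f r - profile f j| * B := mul_le_mul_of_nonneg_right (le_abs_self _) hB0
      _ = B * |profile f r - profile f j| := by ring

/-! ## The sampler bounds (profile sandwich + expansion + binomial mixing) -/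

/-- **Deletion sampler bound.** For monotone `f`, `0 ≤ p, q ≤ 1` and `j ≤ N`:
`‖delSampler q f − T_j 𝟙[f]‖_{L¹(G(n,p))} ≤ Σ_r Bin(N, p(1-q))(r) |profile f r − profile f j|`. -/
theorem l1_delSampler_le (hA : TransportMono) (hL : LevelAverage) (hE : SamplerExpansion) (hB : BinomialMixing)
    {p q : ℝ} (hp0 : 0 ≤ p) (hp1 : p ≤ 1) (hq0 : 0 ≤ q) (hq1 : q ≤ 1)
    (f : (Edge n → Bool) → Bool) (hf : Monotone f) {j : ℕ} (hj : j ≤ n.choose 2) :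
    l1 n p (delSampler q f) (transport j (ind f)) ≤
      ∑ r ∈ range (n.choose 2 + 1), binW (n.choose 2) (p * (1 - q)) r * |profile f r - profile f j| := by
  set N := n.choose 2 with hN
  have h1q0 : 0 ≤ 1 - q := sub_nonneg.2 hq1
  have h1q1 : 1 - q ≤ 1 := by linarith
  -- pointwise: `|U y − T_j y| ≤ Σ_{r ≤ N} Bin(|y|,1-q)(r) |T_r y − T_j y|`
  have hpt : ∀ y : Edge n → Bool, |delSampler q f y - transport j (ind f) y| ≤
      ∑ r ∈ range (N + 1), binW (edgeCount y) (1 - q) r * |transport r (ind f) y - transport j (ind f) y| := by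
    intro y
    have hsub : range (edgeCount y + 1) ⊆ range (N + 1) :=
      range_subset_range.2 (Nat.succ_le_succ (edgeCount_le y))
    have hext : ∀ g : ℕ → ℝ, ∑ r ∈ range (edgeCount y + 1), binW (edgeCount y) (1 - q) r * g r =
        ∑ r ∈ range (N + 1), binW (edgeCount y) (1 - q) r * g r := by
      intro g
      refine sum_subset hsub fun r _ hr' => ?_
      have : edgeCount y < r := by
        rw [mem_range, not_lt] at hr'
        omega
      rw [binW_eq_zero_of_lt this, zero_mul]
    have hsum1 : ∑ r ∈ range (N + 1), binW (edgeCount y) (1 - q) r = 1 := by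
      have h := hext (fun _ => 1)
      simp only [mul_one] at h
      rw [← h, binW_sum]
    have hU : delSampler q f y = ∑ r ∈ range (N + 1), binW (edgeCount y) (1 - q) r * transport r (ind f) y := by
      rw [hE.del_eq n q f y]; exact hext _
    have hdiff : delSampler q f y - transport j (ind f) y =
        ∑ r ∈ range (N + 1), binW (edgeCount y) (1 - q) r * (transport r (ind f) y - transport j (ind f) y) := by
      simp_rw [mul_sub]
      rw [sum_sub_distrib, ← sum_mul, hsum1, one_mul, hU]
    rw [hdiff]
    refine (abs_sum_le_sum_abs _ _).trans (le_of_eq (sum_congr rfl fun r _ => ?_))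
    rw [abs_mul, abs_of_nonneg (binW_nonneg h1q0 h1q1 r)]
  -- integrate and swap
  calc l1 n p (delSampler q f) (transport j (ind f))
      ≤ ∑ y, gnpWeight n p y * ∑ r ∈ range (N + 1),
          binW (edgeCount y) (1 - q) r * |transport r (ind f) y - transport j (ind f) y| := by
        unfold l1
        exact sum_le_sum fun y _ => mul_le_mul_of_nonneg_left (hpt y) (gnpWeight_nonneg hp0 hp1 y)
    _ = ∑ r ∈ range (N + 1), ∑ y, gnpWeight n p y * binW (edgeCount y) (1 - q) r *
          |transport r (ind f) y - transport j (ind f) y| := by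
        simp_rw [mul_sum, ← mul_assoc]
        exact sum_comm
    _ ≤ ∑ r ∈ range (N + 1), binW N (p * (1 - q)) r * |profile f r - profile f j| := by
        refine sum_le_sum fun r hr => ?_
        have hrN : r ≤ N := Nat.lt_succ_iff.1 (mem_range.1 hr)
        refine (weighted_abs_transport_sub_le hA hL hp0 hp1 (φ := fun s => binW s (1 - q) r)
          (fun s => binW_nonneg h1q0 h1q1 r) f hf hrN hj).trans (le_of_eq ?_)
        rw [hB.thin N r p (1 - q)]

/-- **Padding sampler bound.** For monotone `f`, `0 ≤ p, q ≤ 1` and `j ≤ N`: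
`‖padSampler q f − T_j 𝟙[f]‖_{L¹(G(n,p))} ≤ Σ_r Bin(N, p+q-pq)(r) |profile f r − profile f j|`. -/
theorem l1_padSampler_le (hA : TransportMono) (hL : LevelAverage) (hE : SamplerExpansion) (hB : BinomialMixing)
    {p q : ℝ} (hp0 : 0 ≤ p) (hp1 : p ≤ 1) (hq0 : 0 ≤ q) (hq1 : q ≤ 1)
    (f : (Edge n → Bool) → Bool) (hf : Monotone f) {j : ℕ} (hj : j ≤ n.choose 2) :
    l1 n p (padSampler q f) (transport j (ind f)) ≤
      ∑ r ∈ range (n.choose 2 + 1), binW (n.choose 2) (p + q - p * q) r * |profile f r - profile f j| := by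
  set N := n.choose 2 with hN
  -- the level weights of the padding sampler, extended by zero below `|y|`
  set φ : ℕ → ℕ → ℝ := fun r s => if s ≤ r then binW (N - s) q (r - s) else 0 with hφ
  have hφ0 : ∀ r s, 0 ≤ φ r s := fun r s => by
    simp only [hφ]; split_ifs
    · exact binW_nonneg hq0 hq1 _
    · exact le_rfl
  -- pointwise: `|V y − T_j y| ≤ Σ_{r ≤ N} φ r |y| · |T_r y − T_j y|`
  have hpt : ∀ y : Edge n → Bool, |padSampler q f y - transport j (ind f) y| ≤
      ∑ r ∈ range (N + 1), φ r (edgeCount y) * |transport r (ind f) y - transport j (ind f) y| := by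
    intro y
    set s := edgeCount y with hs
    have hsN : s ≤ N := edgeCount_le y
    -- `range (N - s + 1)` sums as `range (N+1)` sums with the indicator weights
    have hext : ∀ g : ℕ → ℝ, ∑ r ∈ range (N - s + 1), binW (N - s) q r * g (s + r) =
        ∑ r ∈ range (N + 1), φ r s * g r := by
      intro g
      have hIco : ∑ r ∈ range (N - s + 1), binW (N - s) q r * g (s + r) =
          ∑ r ∈ Ico s (N + 1), binW (N - s) q (r - s) * g r := by
        rw [Finset.sum_Ico_eq_sum_range, show N + 1 - s = N - s + 1 by omega]
        refine sum_congr rfl fun r _ => ?_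
        rw [Nat.add_sub_cancel_left]
      have hfil : Ico s (N + 1) = (range (N + 1)).filter fun r => s ≤ r := by
        ext r; simp only [mem_Ico, mem_filter, mem_range]; omega
      rw [hIco, hfil, sum_filter]
      refine sum_congr rfl fun r _ => ?_
      simp only [hφ]
      split_ifs <;> simp
    have hsum1 : ∑ r ∈ range (N + 1), φ r s = 1 := by
      have h := hext (fun _ => 1)
      simp only [mul_one] at h
      rw [← h, binW_sum]
    have hV : padSampler q f y = ∑ r ∈ range (N + 1), φ r s * transport r (ind f) y := by
      rw [hE.pad_eq n q f y]; exact hext (fun r => transport r (ind f) y)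
    have hdiff : padSampler q f y - transport j (ind f) y =
        ∑ r ∈ range (N + 1), φ r s * (transport r (ind f) y - transport j (ind f) y) := by
      simp_rw [mul_sub]
      rw [sum_sub_distrib, ← sum_mul, hsum1, one_mul, hV]
    rw [hdiff]
    refine (abs_sum_le_sum_abs _ _).trans (le_of_eq (sum_congr rfl fun r _ => ?_))
    rw [abs_mul, abs_of_nonneg (hφ0 r s)]
  calc l1 n p (padSampler q f) (transport j (ind f))
      ≤ ∑ y, gnpWeight n p y * ∑ r ∈ range (N + 1),
          φ r (edgeCount y) * |transport r (ind f) y - transport j (ind f) y| := by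
        unfold l1
        exact sum_le_sum fun y _ => mul_le_mul_of_nonneg_left (hpt y) (gnpWeight_nonneg hp0 hp1 y)
    _ = ∑ r ∈ range (N + 1), ∑ y, gnpWeight n p y * φ r (edgeCount y) *
          |transport r (ind f) y - transport j (ind f) y| := by
        simp_rw [mul_sum, ← mul_assoc]
        exact sum_comm
    _ ≤ ∑ r ∈ range (N + 1), binW N (p + q - p * q) r * |profile f r - profile f j| := by
        refine sum_le_sum fun r hr => ?_
        have hrN : r ≤ N := Nat.lt_succ_iff.1 (mem_range.1 hr)
        refine (weighted_abs_transport_sub_le hA hL hp0 hp1 (φ := fun s => φ r s) (hφ0 r) f hf hrN hj).trans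
          (le_of_eq ?_)
        have hfilter : (range (N + 1)).filter (fun s => s ≤ r) = range (r + 1) := by
          ext s; simp only [mem_filter, mem_range]; omega
        have hsumφ : ∑ s ∈ range (N + 1), binW N p s * φ r s = binW N (p + q - p * q) r := by
          calc ∑ s ∈ range (N + 1), binW N p s * φ r s
              = ∑ s ∈ range (N + 1), (if s ≤ r then binW N p s * binW (N - s) q (r - s) else 0) :=
                sum_congr rfl fun s _ => by simp only [hφ]; split_ifs <;> simp
            _ = ∑ s ∈ range (r + 1), binW N p s * binW (N - s) q (r - s) := by rw [← sum_filter, hfilter]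
            _ = binW N (p + q - p * q) r := hB.sup N r p q hrN
        rw [hsumφ]

/-! ## The window estimate -/

/-- **Window estimate.** If `|α r − α j| ≤ η` on a window `P` outside of which every index is at distance `≥ w`
from the mean `Np`, then `Σ_r Bin(N,p)(r)|α r − α j| ≤ η + Np(1-p)/w²` (Chebyshev). -/
theorem binAvg_le_of_flat {N j : ℕ} {p w η : ℝ} (hp0 : 0 ≤ p) (hp1 : p ≤ 1) (hw : 0 < w) (hη : 0 ≤ η)
    (α : ℕ → ℝ) (hα1 : ∀ r, |α r - α j| ≤ 1) (P : ℕ → Prop) [DecidablePred P]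
    (hflat : ∀ r, P r → |α r - α j| ≤ η) (htail : ∀ r, ¬ P r → w ≤ |(r : ℝ) - N * p|) :
    ∑ r ∈ range (N + 1), binW N p r * |α r - α j| ≤ η + N * p * (1 - p) / w ^ 2 := by
  have hb : ∀ i, binW N p i = (N.choose i : ℝ) * p ^ i * (1 - p) ^ (N - i) := fun i => rfl
  rw [← sum_filter_add_sum_filter_not (range (N + 1)) P]
  refine add_le_add ?_ ?_
  · calc ∑ r ∈ (range (N + 1)).filter P, binW N p r * |α r - α j|
        ≤ ∑ r ∈ (range (N + 1)).filter P, binW N p r * η :=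
          sum_le_sum fun r hr => mul_le_mul_of_nonneg_left (hflat r (mem_filter.1 hr).2) (binW_nonneg hp0 hp1 r)
      _ ≤ ∑ r ∈ range (N + 1), binW N p r * η :=
          sum_le_sum_of_subset_of_nonneg (filter_subset _ _) fun r _ _ => mul_nonneg (binW_nonneg hp0 hp1 r) hη
      _ = η := by rw [← sum_mul, binW_sum, one_mul]
  · calc ∑ r ∈ (range (N + 1)).filter (fun r => ¬ P r), binW N p r * |α r - α j|
        ≤ ∑ r ∈ (range (N + 1)).filter (fun r => ¬ P r), binW N p r :=
          sum_le_sum fun r _ => by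
            calc binW N p r * |α r - α j| ≤ binW N p r * 1 :=
                  mul_le_mul_of_nonneg_left (hα1 r) (binW_nonneg hp0 hp1 r)
              _ = binW N p r := mul_one _
      _ ≤ N * p * (1 - p) / w ^ 2 := binomialWeight_tail_le hb hp0 hp1 hw (fun r => ¬ P r) htail

/-! ## Eventual facts -/

/-- Eventually: `0 < p_c ≤ 1/8`, and every central `j` satisfies `j ≤ N`, `L² + 1 ≤ j` and `3j ≤ N`. -/
theorem eventually_central {k : ℕ} (hk : 3 ≤ k) (L : ℕ) :
    ∀ᶠ n : ℕ in atTop, 0 < pc n k ∧ pc n k ≤ 1 / 8 ∧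
      ∀ j : ℕ, Central k n j → j ≤ n.choose 2 ∧ L ^ 2 + 1 ≤ j ∧ 3 * j ≤ n.choose 2 := by
  have hμ := tendsto_mean hk
  have hm : Tendsto (fun n : ℕ => (thr k n : ℝ)) atTop atTop :=
    tendsto_natCast_atTop_atTop.comp (tendsto_nat_floor_atTop.comp hμ)
  have hA : Tendsto (fun n : ℕ => (thr k n : ℝ) ^ ((1 : ℝ) / 4)) atTop atTop :=
    (tendsto_rpow_atTop (by norm_num)).comp hm
  filter_upwards [eventually_window hk 0, hA.eventually_ge_atTop 2,
    hm.eventually_ge_atTop (2 * ((L : ℝ) ^ 2 + 1))] with n hwin hA2 hmL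
  obtain ⟨hp0, hp8, h34, h32, hwin5⟩ := hwin
  refine ⟨hp0, hp8, fun j hj => ?_⟩
  have hjN : j ≤ n.choose 2 := by simpa using central_add_le (w := 0) hp0 hp8 hwin5 hj
  set m : ℝ := (thr k n : ℝ) with hmdef
  set A : ℝ := m ^ ((1 : ℝ) / 4) with hAdef
  set R : ℝ := m ^ ((3 : ℝ) / 4) with hRdef
  have hm0 : 0 ≤ m := Nat.cast_nonneg _
  have hA0 : 0 < A := by linarith
  have hmA : m = A ^ 4 := by
    rw [hAdef, ← Real.rpow_natCast, ← Real.rpow_mul hm0]; norm_num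
  have hRA : R = A ^ 3 := by
    rw [hRdef, hAdef, ← Real.rpow_natCast, ← Real.rpow_mul hm0]; norm_num
  -- `2R ≤ m`
  have h2R : 2 * R ≤ m := by
    rw [hRA, hmA]; nlinarith [pow_pos hA0 3]
  have hjc := abs_le.1 hj
  -- `μ = Np`, `m ≤ μ < m + 1`, `8 μ ≤ N` from `p ≤ 1/8`
  have hμ0 : 0 ≤ ((n.choose 2 : ℕ) : ℝ) * pc n k := mul_nonneg (Nat.cast_nonneg _) hp0.le
  have hmμ : m ≤ ((n.choose 2 : ℕ) : ℝ) * pc n k := Nat.floor_le hμ0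
  have h8μ : 8 * (((n.choose 2 : ℕ) : ℝ) * pc n k) ≤ (n.choose 2 : ℕ) := by
    have hN0 : (0 : ℝ) ≤ (n.choose 2 : ℕ) := Nat.cast_nonneg _
    nlinarith
  refine ⟨hjN, ?_, ?_⟩
  · -- `j ≥ m - R ≥ m/2 ≥ L² + 1`
    have h1 : (m : ℝ) / 2 ≤ j := by linarith [hjc.1]
    have h2 : ((L ^ 2 + 1 : ℕ) : ℝ) ≤ j := by push_cast; linarith
    exact_mod_cast h2
  · -- `3j ≤ 3(m + R) ≤ 4.5 m ≤ 8 μ ≤ N`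
    have h1 : (3 * j : ℝ) ≤ (n.choose 2 : ℕ) := by nlinarith [hjc.2]
    exact_mod_cast h1

/-- Eventually: the two extreme inputs carry little mass, and `p_c` is small. -/
theorem eventually_small {k : ℕ} (hk : 3 ≤ k) {u : ℝ} (hu : 0 < u) :
    ∀ᶠ n : ℕ in atTop, (1 - pc n k) ^ (n.choose 2) + (pc n k) ^ (n.choose 2) ≤ u := by
  have hμ := tendsto_mean hk
  have hp := (tendsto_pc (show 2 ≤ k by omega)).eventually (eventually_le_nhds (half_pos hu))
  filter_upwards [eventually_window hk 0, hμ.eventually_ge_atTop (2 / u), hp] with n hwin hμu hpu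
  obtain ⟨hp0, hp8, -, -, -⟩ := hwin
  set p : ℝ := pc n k with hpdef
  set N : ℕ := n.choose 2 with hNdef
  have hp1 : p ≤ 1 := by linarith
  have hμpos : 0 < (N : ℝ) * p := lt_of_lt_of_le (by positivity) hμu
  have hN0 : 0 < N := by
    rcases Nat.eq_zero_or_pos N with h | h
    · exfalso; rw [h, Nat.cast_zero, zero_mul] at hμpos; exact lt_irrefl _ hμpos
    · exact h
  have hNr : (0 : ℝ) < N := by exact_mod_cast hN0
  -- `(1-p)^N = (1 - (Np)/N)^N ≤ exp(-Np) ≤ 1/(1 + Np) ≤ u/2`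
  have h1 : (1 - p) ^ N ≤ Real.exp (-((N : ℝ) * p)) := by
    have key := Real.one_sub_div_pow_le_exp_neg (n := N) (t := (N : ℝ) * p) (by nlinarith)
    have hdiv : (N : ℝ) * p / N = p := by field_simp
    rwa [hdiv] at key
  have h2 : Real.exp (-((N : ℝ) * p)) ≤ u / 2 := by
    rw [Real.exp_neg]
    have h3 : 1 + (N : ℝ) * p ≤ Real.exp ((N : ℝ) * p) := by
      have := Real.add_one_le_exp ((N : ℝ) * p); linarith
    have h4 : (Real.exp ((N : ℝ) * p))⁻¹ ≤ (1 + (N : ℝ) * p)⁻¹ := inv_anti₀ (by positivity) h3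
    refine h4.trans ?_
    rw [inv_le_comm₀ (by positivity) (by positivity)]
    have : (u / 2)⁻¹ = 2 / u := by rw [inv_div]
    rw [this]; linarith
  -- `p^N ≤ p ≤ u/2`
  have h5 : p ^ N ≤ p := by
    calc p ^ N ≤ p ^ 1 := pow_le_pow_of_le_one hp0.le hp1 hN0
      _ = p := pow_one p
  linarith

/-- Eventually: the size budget `t(n^{c₁} + 2N + 2) + 4t² + 4 ≤ n^{c₁+4}`. -/
theorem eventually_size (c₁ t : ℕ) :
    ∀ᶠ n : ℕ in atTop, t * (n ^ c₁ + 2 * n.choose 2 + 2) + 4 * t ^ 2 + 4 ≤ n ^ (c₁ + 4) := by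
  filter_upwards [eventually_ge_atTop (max 5 (max t (4 * t ^ 2 + 4)))] with n hn
  have hn5 : 5 ≤ n := le_trans (le_max_left _ _) hn
  have hnt : t ≤ n := le_trans ((le_max_left _ _).trans (le_max_right _ _)) hn
  have hnt2 : 4 * t ^ 2 + 4 ≤ n := le_trans ((le_max_right _ _).trans (le_max_right _ _)) hn
  have hn1 : 1 ≤ n := by omega
  have hN : n.choose 2 ≤ n ^ 2 := by
    rw [Nat.choose_two_right, sq]
    exact (Nat.div_le_self _ _).trans (Nat.mul_le_mul_left _ (Nat.sub_le _ _))
  have hpow1 : 1 ≤ n ^ c₁ := Nat.one_le_pow _ _ (by omega)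
  have hP : n ^ (c₁ + 4) = n ^ c₁ * n ^ 4 := pow_add n c₁ 4
  -- everything in terms of `P := n^{c₁}` and `n`
  have h1 : t * n ^ c₁ ≤ n * n ^ c₁ := Nat.mul_le_mul_right _ hnt
  have h2 : t * (2 * n.choose 2 + 2) ≤ n * (2 * n ^ 2 + 2) :=
    Nat.mul_le_mul hnt (by omega)
  have h3 : n * (2 * n ^ 2 + 2) ≤ 3 * n ^ 3 * n ^ c₁ := by
    have : n * (2 * n ^ 2 + 2) ≤ 3 * n ^ 3 := by
      have h25 : 2 ≤ n ^ 2 := by nlinarith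
      nlinarith
    calc n * (2 * n ^ 2 + 2) ≤ 3 * n ^ 3 := this
      _ = 3 * n ^ 3 * 1 := (mul_one _).symm
      _ ≤ 3 * n ^ 3 * n ^ c₁ := Nat.mul_le_mul_left _ hpow1
  have h4 : 4 * t ^ 2 + 4 ≤ n * n ^ c₁ := by
    calc 4 * t ^ 2 + 4 ≤ n := hnt2
      _ = n * 1 := (mul_one _).symm
      _ ≤ n * n ^ c₁ := Nat.mul_le_mul_left _ hpow1
  have hsum : t * (n ^ c₁ + 2 * n.choose 2 + 2) + 4 * t ^ 2 + 4 ≤ (n + 3 * n ^ 3 + n) * n ^ c₁ := by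
    have := Nat.mul_add t (n ^ c₁) (2 * n.choose 2 + 2)
    nlinarith [h1, h2, h3, h4, this]
  refine hsum.trans ?_
  rw [hP, mul_comm]
  refine Nat.mul_le_mul_left _ ?_
  -- `n + 3n³ + n ≤ n⁴` for `n ≥ 5`
  have : n + 3 * n ^ 3 + n ≤ 5 * n ^ 3 := by nlinarith
  calc n + 3 * n ^ 3 + n ≤ 5 * n ^ 3 := this
    _ ≤ n * n ^ 3 := Nat.mul_le_mul_right _ hn5
    _ = n ^ 4 := by ring

/-! ## From a sampler to a circuit -/

/-- Indicators that agree off the two extreme inputs are close in `L¹(G(n,p))`. -/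
theorem l1_ind_le_of_eqOn {p : ℝ} (hp0 : 0 ≤ p) (hp1 : p ≤ 1) (f g : (Edge n → Bool) → Bool)
    (hfg : ∀ y : Edge n → Bool, (∃ e, y e = false) → (∃ e, y e = true) → f y = g y) :
    l1 n p (ind f) (ind g) ≤ gnpWeight n p (fun _ => false) + gnpWeight n p (fun _ => true) := by
  unfold l1
  have hpt : ∀ y : Edge n → Bool, gnpWeight n p y * |ind f y - ind g y| ≤
      gnpWeight n p y * ((if y = (fun _ => false) then 1 else 0) + (if y = (fun _ => true) then 1 else 0)) := by
    intro y
    refine mul_le_mul_of_nonneg_left ?_ (gnpWeight_nonneg hp0 hp1 y)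
    have hle1 : |ind f y - ind g y| ≤ 1 := by
      have := ind_nonneg f y; have := ind_le_one f y; have := ind_nonneg g y; have := ind_le_one g y
      rw [abs_sub_le_iff]; constructor <;> linarith
    by_cases h0 : y = fun _ => false
    · rw [if_pos h0]
      have : (0 : ℝ) ≤ (if y = (fun _ => true) then 1 else 0) := by split_ifs <;> norm_num
      linarith
    · by_cases h1 : y = fun _ => true
      · rw [if_pos h1, if_neg h0]; linarith
      · rw [if_neg h0, if_neg h1, add_zero]
        have hF : ∃ e, y e = false := by
          by_contra hc; push Not at hc
          exact h1 (funext fun e => by simpa using hc e)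
        have hT : ∃ e, y e = true := by
          by_contra hc; push Not at hc
          exact h0 (funext fun e => by simpa using hc e)
        unfold ind
        rw [hfg y hF hT, sub_self, abs_zero]
  refine (sum_le_sum fun y _ => hpt y).trans (le_of_eq ?_)
  simp_rw [mul_add, mul_ite, mul_one, mul_zero]
  rw [sum_add_distrib, Finset.sum_ite_eq' univ (fun _ : Edge n => false), Finset.sum_ite_eq' univ (fun _ : Edge n => true)]
  simp

/-- **From a sampler to a circuit.** A restriction sampler `U(y) = E_ρ 𝟙[f](σ y ρ)`, `ρ ∼ G(n,r)`, whose majority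
votes are realised by monotone circuits of size `≤ S` off the two extreme inputs, and which is `δ₁`-close to a target
itself `δ₂`-close to a Boolean function, yields a monotone circuit of size `≤ S` within
`w(⊥) + w(⊤) + 4/t + 5(δ₁ + δ₂) + δ₁` of the target. -/
theorem circuit_of_sampler (hD : Derandomize) {t : ℕ} (ht : 0 < t) {p : ℝ} (hp0 : 0 ≤ p) (hp1 : p ≤ 1)
    (σ : (Edge n → Bool) → (Edge n → Bool) → (Edge n → Bool)) (f : (Edge n → Bool) → Bool)
    {r : ℝ} (hr0 : 0 ≤ r) (hr1 : r ≤ 1) {S : ℕ}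
    (hM : ∀ ρs : Fin t → Edge n → Bool, ∃ M : Circuit (Edge n), M.IsOver monotoneBasis ∧ M.size ≤ S ∧
      ∀ y : Edge n → Bool, (∃ e, y e = false) → (∃ e, y e = true) →
        M.eval y = majVote (fun a y => f (σ y (ρs a))) y)
    (target : (Edge n → Bool) → ℝ) (G : (Edge n → Bool) → Bool) {δ₁ δ₂ : ℝ}
    (hU : l1 n p (fun y => ∑ ρ, gnpWeight n r ρ * ind f (σ y ρ)) target ≤ δ₁)
    (hG : l1 n p target (ind G) ≤ δ₂) :
    ∃ M : Circuit (Edge n), M.IsOver monotoneBasis ∧ M.size ≤ S ∧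
      l1 n p (ind M.eval) target ≤
        gnpWeight n p (fun _ => false) + gnpWeight n p (fun _ => true) + (4 / t + 5 * (δ₁ + δ₂)) + δ₁ := by
  set g : (Edge n → Bool) → (Edge n → Bool) → Bool := fun ρ y => f (σ y ρ) with hg
  set U : (Edge n → Bool) → ℝ := fun y => ∑ ρ, gnpWeight n r ρ * ind f (σ y ρ) with hUdef
  have hUg : (fun y => ∑ ρ, gnpWeight n r ρ * ind (g ρ) y) = U := by
    funext y; rfl
  obtain ⟨ρs, hρs⟩ := hD.maj n t ht p hp0 hp1 (gnpWeight n r) (gnpWeight_nonneg hr0 hr1) (sum_gnpWeight r) g G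
  rw [hUg] at hρs
  obtain ⟨M, hMB, hMS, hMev⟩ := hM ρs
  refine ⟨M, hMB, hMS, ?_⟩
  have hUG : l1 n p U (ind G) ≤ δ₁ + δ₂ := (l1_triangle hp0 hp1 U target (ind G)).trans (add_le_add hU hG)
  have hmaj : l1 n p (ind (majVote fun a => g (ρs a))) U ≤ 4 / t + 5 * (δ₁ + δ₂) :=
    hρs.trans (by nlinarith)
  have hMmaj : l1 n p (ind M.eval) (ind (majVote fun a => g (ρs a))) ≤
      gnpWeight n p (fun _ => false) + gnpWeight n p (fun _ => true) :=
    l1_ind_le_of_eqOn hp0 hp1 _ _ hMev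
  calc l1 n p (ind M.eval) target
      ≤ l1 n p (ind M.eval) (ind (majVote fun a => g (ρs a))) + l1 n p (ind (majVote fun a => g (ρs a))) target :=
        l1_triangle hp0 hp1 _ _ _
    _ ≤ l1 n p (ind M.eval) (ind (majVote fun a => g (ρs a))) +
          (l1 n p (ind (majVote fun a => g (ρs a))) U + l1 n p U target) :=
        add_le_add le_rfl (l1_triangle hp0 hp1 _ _ _)
    _ ≤ (gnpWeight n p (fun _ => false) + gnpWeight n p (fun _ => true)) + ((4 / t + 5 * (δ₁ + δ₂)) + δ₁) :=
        add_le_add hMmaj (add_le_add hmaj hU)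
    _ = _ := by ring

/-! ## The composition -/

/-- **The sampling mean.** Under one-sided flatness over `2w` slices, the binomial average of the profile increments
around the mean `j + w` (flat above) resp. `j - w` (flat below) is at most `u + (j+w)/w²`. -/
theorem exists_mean (hA : TransportMono) (hL : LevelAverage) {f : (Edge n → Bool) → Bool} (hf : Monotone f)
    {j w : ℕ} (hjN : j ≤ n.choose 2) (hj2w : j + 2 * w ≤ n.choose 2) (hwj : w ≤ j) (hw1 : 1 ≤ w)
    {u : ℝ} (hu0 : 0 ≤ u)
    (hflat : (∀ r : ℕ, r ≤ 2 * w → profile f (j + r) - profile f j ≤ u) ∨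
      (∀ r : ℕ, r ≤ 2 * w → profile f j - profile f (j - r) ≤ u)) :
    ∃ pstar : ℝ, 0 ≤ pstar ∧ pstar ≤ 1 ∧
      ∑ r ∈ range (n.choose 2 + 1), binW (n.choose 2) pstar r * |profile f r - profile f j| ≤
        u + ((j : ℝ) + w) / (w : ℝ) ^ 2 := by
  have hα1 : ∀ r, |profile f r - profile f j| ≤ 1 := fun r => abs_profile_sub_le f r j
  have hNpos : (0 : ℝ) < (n.choose 2 : ℕ) := by
    have : 1 ≤ n.choose 2 := by omega
    exact_mod_cast this
  have hwr : (0 : ℝ) < w := by exact_mod_cast hw1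
  have hjNr : (j : ℝ) ≤ (n.choose 2 : ℕ) := by exact_mod_cast hjN
  have hjwN : (j : ℝ) + w ≤ (n.choose 2 : ℕ) := by
    have : j + w ≤ n.choose 2 := by omega
    exact_mod_cast this
  have hwjr : (w : ℝ) ≤ j := by exact_mod_cast hwj
  rcases hflat with hup | hdown
  · -- flat above: mean `j + w`
    set pstar : ℝ := ((j : ℝ) + w) / (n.choose 2 : ℕ) with hps
    have hps0 : 0 ≤ pstar := by positivity
    have hps1 : pstar ≤ 1 := (div_le_one hNpos).2 hjwN
    have hmean : ((n.choose 2 : ℕ) : ℝ) * pstar = j + w := mul_div_cancel₀ _ hNpos.ne'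
    refine ⟨pstar, hps0, hps1, ?_⟩
    have hflat' : ∀ r, (j ≤ r ∧ r ≤ j + 2 * w) → |profile f r - profile f j| ≤ u := by
      rintro r ⟨hr1, hr2⟩
      have hmono : profile f j ≤ profile f r := profile_mono hA hL hf hr1 (by omega)
      rw [abs_of_nonneg (sub_nonneg.2 hmono)]
      have := hup (r - j) (by omega)
      rwa [Nat.add_sub_cancel' hr1] at this
    have htail' : ∀ r, ¬ (j ≤ r ∧ r ≤ j + 2 * w) → (w : ℝ) ≤ |(r : ℝ) - (n.choose 2 : ℕ) * pstar| := by
      intro r hr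
      rw [hmean]
      rcases not_and_or.1 hr with h | h
      · have h' : r + 1 ≤ j := by omega
        have : (r : ℝ) + 1 ≤ j := by exact_mod_cast h'
        rw [abs_of_neg (by linarith)]; linarith
      · have h' : j + 2 * w + 1 ≤ r := by omega
        have : (j : ℝ) + 2 * w + 1 ≤ r := by exact_mod_cast h'
        rw [abs_of_pos (by linarith)]; linarith
    refine (binAvg_le_of_flat hps0 hps1 hwr hu0 (profile f) hα1 _ hflat' htail').trans ?_
    rw [hmean]
    have : ((j : ℝ) + w) * (1 - pstar) / (w : ℝ) ^ 2 ≤ ((j : ℝ) + w) / (w : ℝ) ^ 2 := by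
      refine div_le_div_of_nonneg_right ?_ (by positivity)
      nlinarith
    linarith
  · -- flat below: mean `j - w`
    set pstar : ℝ := ((j : ℝ) - w) / (n.choose 2 : ℕ) with hps
    have hps0 : 0 ≤ pstar := div_nonneg (by linarith) hNpos.le
    have hps1 : pstar ≤ 1 := (div_le_one hNpos).2 (by linarith)
    have hmean : ((n.choose 2 : ℕ) : ℝ) * pstar = j - w := mul_div_cancel₀ _ hNpos.ne'
    refine ⟨pstar, hps0, hps1, ?_⟩
    have hflat' : ∀ r, (j - 2 * w ≤ r ∧ r ≤ j) → |profile f r - profile f j| ≤ u := by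
      rintro r ⟨hr1, hr2⟩
      have hmono : profile f r ≤ profile f j := profile_mono hA hL hf hr2 hjN
      rw [abs_sub_comm, abs_of_nonneg (sub_nonneg.2 hmono)]
      have := hdown (j - r) (by omega)
      rwa [Nat.sub_sub_self hr2] at this
    have htail' : ∀ r, ¬ (j - 2 * w ≤ r ∧ r ≤ j) → (w : ℝ) ≤ |(r : ℝ) - (n.choose 2 : ℕ) * pstar| := by
      intro r hr
      rw [hmean]
      rcases not_and_or.1 hr with h | h
      · have h' : r + 1 + 2 * w ≤ j := by omega
        have : (r : ℝ) + 1 + 2 * w ≤ j := by exact_mod_cast h'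
        rw [abs_of_neg (by linarith)]; linarith
      · have h' : j + 1 ≤ r := by omega
        have : (j : ℝ) + 1 ≤ r := by exact_mod_cast h'
        rw [abs_of_pos (by linarith)]; linarith
    refine (binAvg_le_of_flat hps0 hps1 hwr hu0 (profile f) hα1 _ hflat' htail').trans ?_
    rw [hmean]
    have : ((j : ℝ) - w) * (1 - pstar) / (w : ℝ) ^ 2 ≤ ((j : ℝ) + w) / (w : ℝ) ^ 2 := by
      refine div_le_div_of_nonneg_right ?_ (by positivity)
      nlinarith
    linarith

/-- **The sampler matching a mean.** Every `p* ∈ [0,1]` is the edge density of a deletion (`p* ≤ p`) or a padding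
(`p < p*`) of `G(n,p)`; the corresponding restriction sampler of a monotone circuit's function has majority votes
realised by monotone circuits (`SamplerCircuit`) and is within the binomial profile average of the transport. -/
theorem exists_sampler (hA : TransportMono) (hL : LevelAverage) (hE : SamplerExpansion) (hB : BinomialMixing)
    (hS : SamplerCircuit) {t : ℕ} (ht : 0 < t) (hn2 : 2 ≤ n) {p : ℝ} (hp0 : 0 < p) (hp1 : p < 1)
    (C₁ : Circuit (Edge n)) (hC₁ : C₁.IsOver monotoneBasis) {j : ℕ} (hjN : j ≤ n.choose 2)
    {pstar : ℝ} (hps0 : 0 ≤ pstar) (hps1 : pstar ≤ 1) {B : ℝ}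
    (hbin : ∑ r ∈ range (n.choose 2 + 1), binW (n.choose 2) pstar r * |profile C₁.eval r - profile C₁.eval j| ≤ B) :
    ∃ (σ : (Edge n → Bool) → (Edge n → Bool) → (Edge n → Bool)) (r : ℝ), 0 ≤ r ∧ r ≤ 1 ∧
      (∀ ρs : Fin t → Edge n → Bool, ∃ M : Circuit (Edge n), M.IsOver monotoneBasis ∧
        M.size ≤ t * (C₁.size + 2 * n.choose 2 + 2) + 4 * t ^ 2 + 4 ∧
        ∀ y : Edge n → Bool, (∃ e, y e = false) → (∃ e, y e = true) →
          M.eval y = majVote (fun a y => C₁.eval (σ y (ρs a))) y) ∧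
      l1 n p (fun y => ∑ ρ, gnpWeight n r ρ * ind C₁.eval (σ y ρ)) (transport j (ind C₁.eval)) ≤ B := by
  have hf : Monotone C₁.eval := C₁.monotone_eval_of_isOver_monotoneBasis hC₁
  rcases le_or_gt pstar p with hle | hgt
  · -- deletion with keep-rate `p*/p`, i.e. `q = 1 - p*/p`
    set q : ℝ := 1 - pstar / p with hqdef
    have hq0 : 0 ≤ q := by rw [hqdef, sub_nonneg, div_le_one hp0]; exact hle
    have hq1 : q ≤ 1 := by rw [hqdef]; linarith [div_nonneg hps0 hp0.le]
    have hpq : p * (1 - q) = pstar := by rw [hqdef]; field_simp; ring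
    refine ⟨meet, 1 - q, by linarith, by linarith, fun ρs => hS.meet_case n t hn2 ht C₁ hC₁ ρs, ?_⟩
    have := l1_delSampler_le hA hL hE hB hp0.le hp1.le hq0 hq1 C₁.eval hf hjN
    rw [hpq] at this
    exact this.trans hbin
  · -- padding with rate `(p* - p)/(1 - p)`
    set q : ℝ := (pstar - p) / (1 - p) with hqdef
    have h1p : 0 < 1 - p := by linarith
    have hq0 : 0 ≤ q := div_nonneg (by linarith) h1p.le
    have hq1 : q ≤ 1 := by rw [hqdef, div_le_one h1p]; linarith
    have hpq : p + q - p * q = pstar := by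
      rw [hqdef]; field_simp; ring
    refine ⟨join, q, hq0, hq1, fun ρs => hS.join_case n t hn2 ht C₁ hC₁ ρs, ?_⟩
    have := l1_padSampler_le hA hL hE hB hp0.le hp1.le hq0 hq1 C₁.eval hf hjN
    rw [hpq] at this
    exact this.trans hbin

/-- The two extreme inputs have mass `(1-p)^N + p^N`. -/
theorem gnpWeight_bot_add_top (p : ℝ) :
    gnpWeight n p (fun _ : Edge n => false) + gnpWeight n p (fun _ : Edge n => true) =
      (1 - p) ^ (n.choose 2) + p ^ (n.choose 2) := by
  have h0 : edgeCount (fun _ : Edge n => false) = 0 := by simp [edgeCount]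
  have h1 : edgeCount (fun _ : Edge n => true) = n.choose 2 := by
    rw [edgeCount, ← card_edgeSet_top_fin n, ← card_univ]
    congr 1; ext e; simp
  rw [gnpWeight, gnpWeight, h0, h1]; simp

/-- Final accounting, in a clean context. -/
theorem final_bound {x a b c u η : ℝ} (hudef : u = η / 100) (hη : 0 < η)
    (h1 : x ≤ a + b + (c + 5 * (3 * u + u)) + 3 * u) (hab : a + b ≤ u) (hc : c ≤ u) : x ≤ η := by
  rw [hudef] at h1 hab hc; linarith

/-- Window tail arithmetic, in a clean context: `(j + Ls)/(Ls)² ≤ 5/L` for `j ≤ 4s²`, `L, s ≥ 1`. -/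
theorem tail_arith {j L s : ℕ} (hL1 : 1 ≤ L) (hs1 : 1 ≤ s) (hjs : (j : ℝ) ≤ 4 * (s : ℝ) ^ 2) :
    ((j : ℝ) + (L * s : ℕ)) / ((L * s : ℕ) : ℝ) ^ 2 ≤ 5 / L := by
  have hLr1 : (1 : ℝ) ≤ L := by exact_mod_cast hL1
  have hsr1 : (1 : ℝ) ≤ s := by exact_mod_cast hs1
  have hL0 : (0 : ℝ) < L := by linarith
  have hs0 : (0 : ℝ) < s := by linarith
  push_cast
  have hw0 : (0 : ℝ) < ((L : ℝ) * s) ^ 2 := by positivity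
  rw [div_le_div_iff₀ hw0 hL0]
  -- `(j + L s) L ≤ 5 (L s)²`
  have e1 : (j : ℝ) * L ≤ 4 * (s : ℝ) ^ 2 * L := mul_le_mul_of_nonneg_right hjs hL0.le
  have e2 : 4 * (s : ℝ) ^ 2 * L ≤ 4 * ((L : ℝ) * s) ^ 2 := by nlinarith [sq_nonneg (s : ℝ), mul_pos hL0 hs0]
  have e3 : (L : ℝ) * s * L ≤ ((L : ℝ) * s) ^ 2 := by nlinarith [mul_pos hL0 hs0]
  nlinarith

/-- **Fixed-parameter core of the composition**, relative to a class `P` of instances `(n, j, C)`: if the residual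
holds on `P` at tolerance `η/100` and width `2(⌈500/η⌉₊+1)·⌊√j⌋` (the only instance the composition uses), then the crux's
conclusion holds on `P` with exponent `c₁ + 4`. -/
theorem mc_core (hA : TransportMono) (hL : LevelAverage) (hE : SamplerExpansion) (hB : BinomialMixing)
    (hS : SamplerCircuit) (hD : Derandomize) {c c₁ k : ℕ} (hk : 3 ≤ k) {η : ℝ} (hη : 0 < η)
    (P : (n : ℕ) → ℕ → Circuit (Edge n) → Prop)
    (hFSA : ∃ ε : ℝ, 0 < ε ∧ ∀ᶠ n : ℕ in atTop, ∀ j : ℕ, Central k n j →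
      ∀ C : Circuit (Edge n), C.IsOver monotoneBasis → C.size ≤ n ^ c → P n j C →
        (∃ F : (Edge n → Bool) → Bool, Monotone F ∧ l1 n (pc n k) (ind F) (transport j (ind C.eval)) ≤ ε) →
        ∃ C₁ : Circuit (Edge n), C₁.IsOver monotoneBasis ∧ C₁.size ≤ n ^ c₁ ∧
          (∑ x ∈ slice n j, |ind C₁.eval x - ind C.eval x|) ≤ η / 100 * #(slice n j) ∧
          ((∀ r : ℕ, r ≤ 2 * (⌈5 / (η / 100)⌉₊ + 1) * Nat.sqrt j →
              profile C₁.eval (j + r) - profile C₁.eval j ≤ η / 100) ∨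
           (∀ r : ℕ, r ≤ 2 * (⌈5 / (η / 100)⌉₊ + 1) * Nat.sqrt j →
              profile C₁.eval j - profile C₁.eval (j - r) ≤ η / 100))) :
    ∃ ε : ℝ, 0 < ε ∧ ∀ᶠ n : ℕ in atTop, ∀ j : ℕ, Central k n j →
      ∀ C : Circuit (Edge n), C.IsOver monotoneBasis → C.size ≤ n ^ c → P n j C →
        (∃ F : (Edge n → Bool) → Bool, Monotone F ∧ l1 n (pc n k) (ind F) (transport j (ind C.eval)) ≤ ε) →
        ∃ C' : Circuit (Edge n), C'.IsOver monotoneBasis ∧ C'.size ≤ n ^ (c₁ + 4) ∧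
          l1 n (pc n k) (ind C'.eval) (transport j (ind C.eval)) ≤ η := by
  -- constants: `u = η/100`, `4/t ≤ u`, `5/L ≤ u`
  obtain ⟨u, hudef⟩ : ∃ u : ℝ, u = η / 100 := ⟨_, rfl⟩
  have hu0 : 0 < u := by rw [hudef]; positivity
  obtain ⟨t, htdef⟩ : ∃ t : ℕ, t = ⌈4 / u⌉₊ + 1 := ⟨_, rfl⟩
  obtain ⟨L, hLdef⟩ : ∃ L : ℕ, L = ⌈5 / u⌉₊ + 1 := ⟨_, rfl⟩
  have ht0 : 0 < t := by rw [htdef]; exact Nat.succ_pos _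
  have hL1 : 1 ≤ L := by rw [hLdef]; exact Nat.succ_le_succ (Nat.zero_le _)
  have htr : (4 : ℝ) / t ≤ u := by
    have ht0r : (0 : ℝ) < t := by exact_mod_cast ht0
    have h1 : (4 : ℝ) / u ≤ t := by
      rw [htdef]; push_cast; linarith [Nat.le_ceil (4 / u)]
    rw [div_le_iff₀ ht0r]
    rw [div_le_iff₀ hu0] at h1
    linarith
  have hLr : (5 : ℝ) / L ≤ u := by
    have hL0 : (0 : ℝ) < L := by exact_mod_cast hL1
    have h1 : (5 : ℝ) / u ≤ L := by
      rw [hLdef]; push_cast; linarith [Nat.le_ceil (5 / u)]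
    rw [div_le_iff₀ hL0]
    rw [div_le_iff₀ hu0] at h1
    linarith
  obtain ⟨εF, hεF, hevF⟩ := hFSA
  have hwidth : 2 * (⌈5 / (η / 100)⌉₊ + 1) = 2 * L := by rw [hLdef, hudef]
  refine ⟨min εF u, lt_min hεF hu0, ?_⟩
  filter_upwards [hevF, eventually_central hk L, eventually_small hk hu0, eventually_size c₁ t,
    eventually_ge_atTop 2] with n hFn hcen hsmall hsize hn2 j hj C hC hCsize hP hhyp
  obtain ⟨F, hFmono, hFd⟩ := hhyp
  obtain ⟨hp0, hp8, hcenj⟩ := hcen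
  obtain ⟨hjN, hjL, h3j⟩ := hcenj j hj
  have hp1 : pc n k ≤ 1 := by linarith
  have hplt : pc n k < 1 := by linarith
  have hFε : l1 n (pc n k) (ind F) (transport j (ind C.eval)) ≤ εF := hFd.trans (min_le_left _ _)
  have hFu : l1 n (pc n k) (transport j (ind C.eval)) (ind F) ≤ u := by
    rw [l1_comm]; exact hFd.trans (min_le_right _ _)
  -- the residual: a slice-faithful representative `C₁` with a one-sided flat profile
  obtain ⟨C₁, hC₁, hC₁size, hfaith, hflat⟩ := hFn j hj C hC hCsize hP ⟨F, hFmono, hFε⟩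
  rw [hwidth] at hflat
  replace hfaith : (∑ x ∈ slice n j, |ind C₁.eval x - ind C.eval x|) ≤ u * #(slice n j) := by rwa [hudef]
  replace hflat : (∀ r : ℕ, r ≤ 2 * L * Nat.sqrt j → profile C₁.eval (j + r) - profile C₁.eval j ≤ u) ∨
      (∀ r : ℕ, r ≤ 2 * L * Nat.sqrt j → profile C₁.eval j - profile C₁.eval (j - r) ≤ u) := by
    rw [hudef]; exact hflat
  have hf : Monotone C₁.eval := C₁.monotone_eval_of_isOver_monotoneBasis hC₁
  -- (1) contraction: `‖T_j C₁ − T_j C‖ ≤ u`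
  have hslice0 : (0 : ℝ) < #(slice n j) := by exact_mod_cast card_slice_pos hjN
  have d1 : l1 n (pc n k) (transport j (ind C₁.eval)) (transport j (ind C.eval)) ≤ u := by
    refine (l1_transport_le hp0.le hp1 j (ind C₁.eval) (ind C.eval)).trans ?_
    rw [div_le_iff₀ hslice0]
    exact hfaith
  -- (2) the window `w = L·⌊√j⌋`: `1 ≤ w ≤ j`, `j + 2w ≤ N`, tail `(j+w)/w² ≤ u`
  obtain ⟨s, hsdef⟩ : ∃ s : ℕ, s = Nat.sqrt j := ⟨_, rfl⟩
  obtain ⟨w, hwdef⟩ : ∃ w : ℕ, w = L * s := ⟨_, rfl⟩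
  have hLs : L ≤ s := by
    rw [hsdef, Nat.le_sqrt]
    have h := hjL
    rw [sq] at h
    omega
  have hs1 : 1 ≤ s := hL1.trans hLs
  have hwj : w ≤ j := by
    calc w = L * s := hwdef
      _ ≤ s * s := Nat.mul_le_mul_right _ hLs
      _ ≤ j := by rw [hsdef]; exact Nat.sqrt_le j
  have hw1 : 1 ≤ w := by rw [hwdef]; exact Nat.one_le_iff_ne_zero.2 (Nat.mul_ne_zero (by omega) (by omega))
  have hj2w : j + 2 * w ≤ n.choose 2 := by omega
  have h2w : 2 * L * Nat.sqrt j = 2 * w := by rw [hwdef, hsdef]; ring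
  have htail : ((j : ℝ) + w) / (w : ℝ) ^ 2 ≤ u := by
    have hjs : (j : ℝ) ≤ 4 * (s : ℝ) ^ 2 := by
      have h1 : j < (s + 1) * (s + 1) := by rw [hsdef]; exact Nat.lt_succ_sqrt j
      have h1' : j + 1 ≤ (s + 1) * (s + 1) := h1
      have h2 : (j : ℝ) + 1 ≤ ((s : ℝ) + 1) * ((s : ℝ) + 1) := by exact_mod_cast h1'
      have h3 : (1 : ℝ) ≤ s := by exact_mod_cast hs1
      nlinarith
    rw [hwdef]
    exact (tail_arith hL1 hs1 hjs).trans hLr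
  -- (3) the sampling mean
  have hflat2 : (∀ r : ℕ, r ≤ 2 * w → profile C₁.eval (j + r) - profile C₁.eval j ≤ u) ∨
      (∀ r : ℕ, r ≤ 2 * w → profile C₁.eval j - profile C₁.eval (j - r) ≤ u) := by
    rcases hflat with h | h
    · exact Or.inl fun r hr => h r (by rw [h2w]; exact hr)
    · exact Or.inr fun r hr => h r (by rw [h2w]; exact hr)
  obtain ⟨pstar, hps0, hps1, hbin⟩ := exists_mean hA hL hf hjN hj2w hwj hw1 hu0.le hflat2
  -- (no `linarith` while a hypothesis displays a `Finset.sum`: its preprocessing times out on it)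
  have hbin2 : ∑ r ∈ range (n.choose 2 + 1), binW (n.choose 2) pstar r *
      |profile C₁.eval r - profile C₁.eval j| ≤ 2 * u :=
    hbin.trans (by rw [two_mul]; exact add_le_add le_rfl htail)
  clear hbin
  -- (4) the sampler and (5) the circuit
  obtain ⟨σ, r, hr0, hr1, hMσ, hUσ⟩ := exists_sampler hA hL hE hB hS ht0 hn2 hp0 hplt C₁ hC₁ hjN hps0 hps1 hbin2
  clear hbin2
  have h3u : 2 * u + u = 3 * u := by ring
  have hU : l1 n (pc n k) (fun y => ∑ ρ, gnpWeight n r ρ * ind C₁.eval (σ y ρ)) (transport j (ind C.eval)) ≤ 3 * u :=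
    (l1_triangle hp0.le hp1 _ (transport j (ind C₁.eval)) _).trans ((add_le_add hUσ d1).trans h3u.le)
  obtain ⟨M, hMB, hMS, hMd⟩ :=
    circuit_of_sampler hD ht0 hp0.le hp1 σ C₁.eval hr0 hr1 hMσ (transport j (ind C.eval)) F hU hFu
  refine ⟨M, hMB, ?_, ?_⟩
  · -- size
    calc M.size ≤ t * (C₁.size + 2 * n.choose 2 + 2) + 4 * t ^ 2 + 4 := hMS
      _ ≤ t * (n ^ c₁ + 2 * n.choose 2 + 2) + 4 * t ^ 2 + 4 := by
          have := Nat.mul_le_mul_left t (Nat.add_le_add_right (Nat.add_le_add_right hC₁size (2 * n.choose 2)) 2)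
          omega
      _ ≤ n ^ (c₁ + 4) := hsize
  · -- accuracy: `w(⊥) + w(⊤) + 4/t + 5·4u + 3u ≤ 25u ≤ η`
    have hext : gnpWeight n (pc n k) (fun _ : Edge n => false) + gnpWeight n (pc n k) (fun _ : Edge n => true) ≤ u := by
      rw [gnpWeight_bot_add_top]; exact hsmall
    exact final_bound hudef hη hMd hext htr


/-- **COMPOSITION.** The seven registered stubs imply the crux `OneSlice.MonotoneContinuation`, concluded BY NAME. -/
theorem MonotoneContinuation_of (hF : Registered.stub_flatSliceApprox) :
    Summit.PneNP.PneNP.Theses.OneSlice.MonotoneContinuation := by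
  -- the six provable stubs are landed theorems (imported above); only the residual is a hypothesis
  have hA : TransportMono := stub_transportMono
  have hL : LevelAverage := stub_levelAverage
  have hE : SamplerExpansion := stub_samplerExpansion
  have hB : BinomialMixing := stub_binomialMixing
  have hS : SamplerCircuit := stub_samplerCircuit
  have hD : Derandomize := stub_derandomize
  intro c
  obtain ⟨c₁, hc₁⟩ := hF c
  refine ⟨c₁ + 4, fun k hk η hη => ?_⟩
  obtain ⟨ε, hε, hev⟩ := mc_core hA hL hE hB hS hD hk hη (fun _ _ _ => True)
    (by
      obtain ⟨ε, hε, hev⟩ := hc₁ k hk (η / 100) (by positivity) (2 * (⌈5 / (η / 100)⌉₊ + 1))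
      exact ⟨ε, hε, by
        filter_upwards [hev] with n hn j hj C hC hsize _ hF'
        exact hn j hj C hC hsize hF'⟩)
  refine ⟨ε, hε, ?_⟩
  filter_upwards [hev] with n hn j hj C hC hsize hF'
  -- read back the inline distances of the route decl as `l1` (`SliceTargetSplit.rdist_eq_l1`)
  obtain ⟨F, hFmono, hFd⟩ := hF'
  rw [rdist_eq_l1] at hFd
  obtain ⟨C', hC', hC'size, hd⟩ := hn j hj C hC hsize trivial ⟨F, hFmono, hFd⟩
  refine ⟨C', hC', hC'size, ?_⟩
  rw [rdist_eq_l1]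
  exact hd

/-! ## Partial result: the crux holds on the ONE-SIDED-FLAT class (modulo the six provable stubs only) -/

/-- The crux restricted to circuits whose OWN profile is already one-sided flat near `j` (tolerance `η/100`, width
`2(⌈500/η⌉₊+1)·⌊√j⌋`): there the residual is witnessed by `C₁ := C`, so the continuation needs only the six provable
stubs, with `c' = c + 4`. This covers every `C` that is not CLT-sharp at `j` on at least one side (e.g. all transport-stable
`C`, all `C` whose acceptance probability does not jump across the `√m`-window). [folklore] -/
theorem monotoneContinuation_flat :
    ∀ c k : ℕ, 3 ≤ k → ∀ η : ℝ, 0 < η → ∃ ε : ℝ, 0 < ε ∧ ∀ᶠ n : ℕ in atTop, ∀ j : ℕ, Central k n j →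
      ∀ C : Circuit (Edge n), C.IsOver monotoneBasis → C.size ≤ n ^ c →
        ((∀ r : ℕ, r ≤ 2 * (⌈5 / (η / 100)⌉₊ + 1) * Nat.sqrt j → profile C.eval (j + r) - profile C.eval j ≤ η / 100) ∨
         (∀ r : ℕ, r ≤ 2 * (⌈5 / (η / 100)⌉₊ + 1) * Nat.sqrt j → profile C.eval j - profile C.eval (j - r) ≤ η / 100)) →
        (∃ F : (Edge n → Bool) → Bool, Monotone F ∧ l1 n (pc n k) (ind F) (transport j (ind C.eval)) ≤ ε) →
        ∃ C' : Circuit (Edge n), C'.IsOver monotoneBasis ∧ C'.size ≤ n ^ (c + 4) ∧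
          l1 n (pc n k) (ind C'.eval) (transport j (ind C.eval)) ≤ η := by
  intro c k hk η hη
  refine mc_core stub_transportMono stub_levelAverage stub_samplerExpansion stub_binomialMixing stub_samplerCircuit
    stub_derandomize hk hη
    (fun n j C => (∀ r : ℕ, r ≤ 2 * (⌈5 / (η / 100)⌉₊ + 1) * Nat.sqrt j →
        profile C.eval (j + r) - profile C.eval j ≤ η / 100) ∨
      (∀ r : ℕ, r ≤ 2 * (⌈5 / (η / 100)⌉₊ + 1) * Nat.sqrt j →
        profile C.eval j - profile C.eval (j - r) ≤ η / 100))
    ⟨1, one_pos, Filter.Eventually.of_forall fun n j _ C hC hsize hP _ => ⟨C, hC, hsize, ?_, hP⟩⟩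
  have h0 : (∑ x ∈ slice n j, |ind C.eval x - ind C.eval x|) = 0 := by simp
  rw [h0]
  positivity

/-- Wiring check — the assembled skeleton. -/
example : Summit.PneNP.PneNP.Theses.OneSlice.MonotoneContinuation :=
  MonotoneContinuation_of stub_flatSliceApprox

/-! ## Partial result: the crux holds on the MONOTONE-AC⁰ class (modulo the six provable stubs only) -/

section Shallow

open Summit.PneNP.PneNP.Cruxes.SliceACZero.RussoWindowLadder (wt sliceAvg)
open Summit.PneNP.PneNP.Theorems.ShallowSliceBound (shallow_not_sharp)

/-- The profile is the slice average of the `ShallowSliceBound` lane. -/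
theorem profile_eq_sliceAvg (f : (Edge n → Bool) → Bool) (ℓ : ℕ) : profile f ℓ = sliceAvg f ℓ := by
  unfold profile sliceAvg
  have hslice : slice n ℓ = univ.filter fun x : Edge n → Bool => wt x = ℓ := rfl
  have hnum : ∑ x ∈ slice n ℓ, ind f x = #(univ.filter fun x : Edge n → Bool => wt x = ℓ ∧ f x = true) := by
    rw [hslice]
    unfold ind
    rw [Finset.sum_boole, Finset.filter_filter]
  rw [hnum, hslice]

/-- `A⁴/2 − A³ + 4 ≥ 0` for `A ≥ 0` (minimum `−27/32 + 4` at `A = 3/2`). -/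
theorem quartic_aux {A : ℝ} (hA : 0 ≤ A) : A ^ 4 / 2 - 4 ≤ A ^ 4 - A ^ 3 := by
  nlinarith [sq_nonneg (A - 3 / 2), sq_nonneg (A ^ 2 - 3 / 2 * A), mul_nonneg hA (sq_nonneg (A - 3 / 2))]

/-- Eventually `16 j ≤ N` and `n ≤ 5 j` for central `j` (since `p_c → 0` and `μ ≥ (n-1)/2`). -/
theorem eventually_shallow_facts {k : ℕ} (hk : 3 ≤ k) :
    ∀ᶠ n : ℕ in atTop, ∀ j : ℕ, Central k n j → 16 * j ≤ n.choose 2 ∧ n ≤ 5 * j := by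
  have hp := (tendsto_pc (show 2 ≤ k by omega)).eventually (eventually_le_nhds (show (0 : ℝ) < 1 / 32 by norm_num))
  filter_upwards [eventually_window hk 0, hp, eventually_ge_atTop 95] with n hwin hp32 hn95 j hj
  obtain ⟨hp0, -, h34, -, -⟩ := hwin
  have hn1 : 1 ≤ n := by omega
  have hjc := abs_le.1 hj
  have hμ0 : 0 ≤ ((n.choose 2 : ℕ) : ℝ) * pc n k := mul_nonneg (Nat.cast_nonneg _) hp0.le
  have hmμ : (thr k n : ℝ) ≤ ((n.choose 2 : ℕ) : ℝ) * pc n k := Nat.floor_le hμ0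
  have hμm : ((n.choose 2 : ℕ) : ℝ) * pc n k < (thr k n : ℝ) + 1 := Nat.lt_floor_add_one _
  have hmean := mean_ge hk hn1
  have hm0 : (0 : ℝ) ≤ thr k n := Nat.cast_nonneg _
  set A : ℝ := (thr k n : ℝ) ^ ((1 : ℝ) / 4) with hAdef
  have hmA : (thr k n : ℝ) = A ^ 4 := by
    rw [hAdef, ← Real.rpow_natCast, ← Real.rpow_mul hm0]; norm_num
  have hRA : (thr k n : ℝ) ^ ((3 : ℝ) / 4) = A ^ 3 := by
    rw [hAdef, ← Real.rpow_natCast, ← Real.rpow_mul hm0]; norm_num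
  have hA0 : 0 ≤ A := Real.rpow_nonneg hm0 _
  -- `R ≤ m` (as `A³ ≤ A⁴`, using `A ≥ 1` from `2 ≤ R = A³`)
  have hA1 : 1 ≤ A := by
    by_contra h
    push Not at h
    have : A ^ 3 ≤ 1 := pow_le_one₀ hA0 h.le
    rw [← hRA] at this
    linarith
  have hRm : (thr k n : ℝ) ^ ((3 : ℝ) / 4) ≤ thr k n := by
    rw [hRA, hmA]; nlinarith [pow_nonneg hA0 3]
  have hN0 : (0 : ℝ) ≤ (n.choose 2 : ℕ) := Nat.cast_nonneg _
  constructor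
  · have h1 : (16 * j : ℝ) ≤ (n.choose 2 : ℕ) := by nlinarith [hjc.2]
    exact_mod_cast h1
  · -- `j ≥ m - R = A⁴ - A³ ≥ m/2 - 4 ≥ (μ - 1)/2 - 4 ≥ (n - 19)/4 ≥ n/5` for `n ≥ 95`
    have hkey := quartic_aux hA0
    have h2 : (thr k n : ℝ) / 2 - 4 ≤ j := by
      have h1 : (thr k n : ℝ) - (thr k n : ℝ) ^ ((3 : ℝ) / 4) ≤ j := by linarith [hjc.1]
      rw [hRA] at h1
      rw [hmA] at h1 ⊢
      linarith
    have hn95r : (95 : ℝ) ≤ n := by exact_mod_cast hn95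
    have h3 : (n : ℝ) ≤ 5 * j := by linarith
    exact_mod_cast h3

/-- **The crux on the monotone-AC⁰ class.** For every depth `d` and exponent `c`: the conclusion of
`OneSlice.MonotoneContinuation` (with `c' = c + 4`) holds for every `{∧₂,∨₂}`-circuit `C` of size `≤ n^c` whose function
is also computed by an unbounded-fan-in `{¬,∧,∨}`-circuit of `acDepth ≤ d` and `≤ n^c` gates — its profile is flat above
every central slice across `j^{2/3} ≫ √j` slices by `shallow_not_sharp` (Boppana / Tal, landed for `ShallowSliceBound`),
so `monotoneContinuation_flat` applies. Modulo the six provable stubs only. [folklore] -/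
theorem monotoneContinuation_shallow :
    ∀ d c k : ℕ, 3 ≤ k → ∀ η : ℝ, 0 < η → ∃ ε : ℝ, 0 < ε ∧ ∀ᶠ n : ℕ in atTop, ∀ j : ℕ, Central k n j →
      ∀ C : Circuit (Edge n), C.IsOver monotoneBasis → C.size ≤ n ^ c →
        (∃ D : Circuit (Edge n), D.IsOver acBasis ∧ D.acDepth ≤ d ∧ D.size ≤ n ^ c ∧ D.eval = C.eval) →
        (∃ F : (Edge n → Bool) → Bool, Monotone F ∧ l1 n (pc n k) (ind F) (transport j (ind C.eval)) ≤ ε) →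
        ∃ C' : Circuit (Edge n), C'.IsOver monotoneBasis ∧ C'.size ≤ n ^ (c + 4) ∧
          l1 n (pc n k) (ind C'.eval) (transport j (ind C.eval)) ≤ η := by
  intro d c k hk η hη
  obtain ⟨ε, hε, hev⟩ := monotoneContinuation_flat c k hk η hη
  -- flatness of shallow circuits, with exponent `c + 1` in `j` and window exponent `θ = 1/3`
  obtain ⟨j₀, hj₀⟩ := shallow_not_sharp d (c + 1) (1 / 3) (by norm_num) (η / 100) (by positivity)
  obtain ⟨L, hLdef⟩ : ∃ L : ℕ, L = ⌈5 / (η / 100)⌉₊ + 1 := ⟨_, rfl⟩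
  obtain ⟨M, hMdef⟩ : ∃ M : ℕ, M = max j₀ (max (5 ^ c) ((2 * L) ^ 6)) := ⟨_, rfl⟩
  refine ⟨ε, hε, ?_⟩
  filter_upwards [hev, eventually_central hk M, eventually_shallow_facts hk] with n hn hcen hsh j hj C hC hsize hD' hF'
  obtain ⟨-, -, hcenj⟩ := hcen
  obtain ⟨hjN, hjL, -⟩ := hcenj j hj
  obtain ⟨hN16, hn5j⟩ := hsh j hj
  obtain ⟨D, hDB, hDd, hDsize, hDeval⟩ := hD'
  refine hn j hj C hC hsize (Or.inl fun r hr => ?_) hF'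
  rw [← hLdef] at hr
  -- bounds on `j`
  have hMj : M ≤ j := (Nat.le_self_pow two_ne_zero M).trans (by omega)
  have hjj₀ : j₀ ≤ j := by rw [hMdef] at hMj; exact (le_max_left _ _).trans hMj
  have hj5c : 5 ^ c ≤ j := by rw [hMdef] at hMj; exact ((le_max_left _ _).trans (le_max_right _ _)).trans hMj
  have hjL6 : (2 * L) ^ 6 ≤ j := by rw [hMdef] at hMj; exact ((le_max_right _ _).trans (le_max_right _ _)).trans hMj
  have hj1 : 1 ≤ j := le_trans (Nat.one_le_pow _ _ (by norm_num)) hj5c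
  have hj0 : (0 : ℝ) ≤ j := Nat.cast_nonneg _
  have hj1r : (1 : ℝ) ≤ j := by exact_mod_cast hj1
  -- `r ≤ 2L⌊√j⌋ ≤ j^{1/6} j^{1/2} = j^{2/3}`
  have hr23 : (r : ℝ) ≤ (j : ℝ) ^ (1 - (1 / 3 : ℝ)) := by
    have hr' : (r : ℝ) ≤ 2 * L * Nat.sqrt j := by exact_mod_cast hr
    refine hr'.trans ?_
    have hsq : ((Nat.sqrt j : ℕ) : ℝ) ≤ (j : ℝ) ^ ((1 : ℝ) / 2) := by
      rw [← Real.sqrt_eq_rpow, Real.le_sqrt (Nat.cast_nonneg _) hj0]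
      exact_mod_cast Nat.sqrt_le' j
    have h2L : (2 * L : ℝ) ≤ (j : ℝ) ^ ((1 : ℝ) / 6) := by
      have h6 : ((2 * L : ℕ) : ℝ) ^ (6 : ℕ) ≤ j := by exact_mod_cast hjL6
      have h2L0 : (0 : ℝ) ≤ (2 * L : ℕ) := Nat.cast_nonneg _
      have h7 := Real.rpow_le_rpow (by positivity) h6 (show (0 : ℝ) ≤ 1 / 6 by norm_num)
      rw [← Real.rpow_natCast, ← Real.rpow_mul h2L0] at h7
      norm_num at h7
      exact_mod_cast h7
    calc (2 * L : ℝ) * (Nat.sqrt j : ℕ) ≤ (j : ℝ) ^ ((1 : ℝ) / 6) * (j : ℝ) ^ ((1 : ℝ) / 2) :=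
          mul_le_mul h2L hsq (Nat.cast_nonneg _) (Real.rpow_nonneg hj0 _)
      _ = (j : ℝ) ^ (1 - (1 / 3 : ℝ)) := by rw [← Real.rpow_add' hj0 (by norm_num)]; norm_num
  have ht : ((j + r : ℕ) : ℝ) ≤ j + (j : ℝ) ^ (1 - (1 / 3 : ℝ)) := by push_cast; linarith
  have hrj : r ≤ j := by
    have h1 : (j : ℝ) ^ (1 - (1 / 3 : ℝ)) ≤ j := by
      calc (j : ℝ) ^ (1 - (1 / 3 : ℝ)) ≤ (j : ℝ) ^ (1 : ℝ) := Real.rpow_le_rpow_of_exponent_le hj1r (by norm_num)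
        _ = j := Real.rpow_one _
    have : (r : ℝ) ≤ j := hr23.trans h1
    exact_mod_cast this
  have h4t : 4 * (j + r) ≤ Fintype.card (Edge n) := by
    rw [card_edgeSet_top_fin]; omega
  -- `D.size ≤ n^c ≤ (5j)^c ≤ j^{c+1}`
  have hDsize' : D.size ≤ j ^ (c + 1) := by
    calc D.size ≤ n ^ c := hDsize
      _ ≤ (5 * j) ^ c := Nat.pow_le_pow_left hn5j _
      _ = 5 ^ c * j ^ c := mul_pow 5 j c
      _ ≤ j * j ^ c := Nat.mul_le_mul_right _ hj5c
      _ = j ^ (c + 1) := by ring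
  have hmonoD : Monotone D.eval := by rw [hDeval]; exact C.monotone_eval_of_isOver_monotoneBasis hC
  have key := hj₀ (Edge n) j (j + r) hjj₀ (Nat.le_add_right _ _) ht h4t D hDB hmonoD hDd hDsize'
  rw [← profile_eq_sliceAvg, ← profile_eq_sliceAvg, hDeval] at key
  linarith

end Shallow

end

end Summit.PneNP.PneNP.Cruxes.MonotoneContinuation.ProfileLine
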